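import Literature.NumberTheory.EllipticCurves.NeronIsogenyScalingIsogenyLayerProofs
import Literature.NumberTheory.EllipticCurves.NeronIsogenyScalingProofs
import Literature.NumberTheory.EllipticCurves.HasseWeilGoodReductionFrobeniusProofs
import Mathlib.Algebra.CharP.Frobenius
import HarnessLib

/-!
# The integral Néron scaling of a rational isogeny between globally minimal models: discharge

`Proofs` file (theorems only, no definitions, no named facts) in topic
`NumberTheory/EllipticCurves`: the last three local steps and the assembly of the proof of the
named fact `Literature.NumberTheory.EllipticCurves.integral_neronScaling_of_isGloballyMinimal`
(`NeronIsogenyScaling.lean`; architecture and the archimedean half in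
`NeronIsogenyScalingProofs.lean`, the `B`-side index bound in
`NeronIsogenyScalingLayerReductionProofs.lean`, the isogeny on layer points in
`NeronIsogenyScalingIsogenyLayerProofs.lean`). Main result:
`Literature.NumberTheory.EllipticCurves.integral_neronScaling_of_isGloballyMinimal_holds`.

* Part A — `q^g - 3` ALGEBRAIC points of `E(K_{2g})` pairwise inequivalent modulo `E₁`
  (`exists_levelZero_family`);
* Part B — `qⁿ` algebraic points on each level `E⁽ʲ⁾(K_n)` pairwise inequivalent modulo
  `E⁽ʲ⁺¹⁾(K_n)` and the product family (`exists_level_family`, `exists_product_family`);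
* Part C — the place-by-place comparison `|c|_v ≤ 1` for the multiplier `c` of a `K`-isogeny
  from a `v`-integral to a `v`-minimal model (`valuation_multiplier_le_one`) and the discharge.

The published proof (Silverman *ATAEC* IV.5.1, IV.6.1, Cor. IV.9.1: Néron mapping property) is
replaced by this elementary count over the unramified layers `K_v(ζ_{qⁿ-1})`, because Néron
models of Weierstrass curves are not available in Mathlib; see `NeronIsogenyScalingProofs.lean`
for the comparison of the two arguments. Each part below keeps its own header.
-/

/-!
## Part A. Level zero: `q^g - 3` algebraic points of `E(K_{2g})` pairwise inequivalent mod `E₁`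

Part A (theorems only): fourth local step of the proof of the named fact
`Literature.NumberTheory.EllipticCurves.integral_neronScaling_of_isGloballyMinimal` by counting
points over unramified layers (architecture: `NeronIsogenyScalingProofs.lean`). This file
produces the **source-side family of level zero**: for `W/K` with `W ⊗ K̄_v` `w`-integral and the
layer `K_n = K_v(ζ)` with `n = 2g`, at least `q^g - 3` ALGEBRAIC points `P ∈ E(K̄)` (needed so
that the isogeny acts on them) whose transports `ι_* P` lie in `E(K_n)`, are `w`-integral, and
have pairwise distinct residues `x̄ ∈ 𝔽_{q^g}`; such points are pairwise inequivalent modulo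
the kernel of reduction `E₁` (the chord through two integral points with `x̄ ≠ x̄'` has integral
slope). Construction (Silverman *AEC* VII.2.1, surjectivity of reduction, made algebraic): for
`x̄ ∈ 𝔽_{q^g} = {0} ∪ μ_{q^g-1}` pick `ȳ` on the reduced curve (`ȳ ∈ 𝔽_{q^{2g}}`: the `q^g`-power
Frobenius permutes the two roots); if `(x̄, ȳ)` is nonsingular — which fails for at most `3`
values of `x̄` (`exists_polynomial_of_not_nonsingular`: a singular point has `x̄` a root of
`(ã₁X + ã₃)² + 4(X³ + ã₂X² + ã₄X + ã₆)`, or of `X² + ã₄` when that polynomial vanishes) — lift it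
by Hensel in the layer with one coordinate a Teichmüller representative `0, ζⁱ` (ALGEBRAIC) and
the other a root of a polynomial with algebraic coefficients (`exists_algebraic_lift_point`, the
proof of the tree's `exists_lift_point_of_pow_eq` with algebraicity tracked).

## References

* [SilvermanAEC2009] J. H. Silverman, *The Arithmetic of Elliptic Curves*, 2nd ed., GTM 106
  (2009): Prop. VII.2.1 and its proof (reduction `E₀(K) → Ẽ_ns(k)` is onto by Hensel; `E₁` is the
  kernel), III.1 (singular points of Weierstrass cubics).
* [SerreLocalFields1979] J.-P. Serre, *Local Fields*, GTM 67 (1979): II §4 Prop. 8.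

## Design

Theorems only (D-0026); setting, notation and hypotheses verbatim those of the previous local
steps (`hw, h𝔐, hF, hr, hrF, hn, hζ`, `W`, `ι`), local `notation3` as in
`NeronIsogenyScalingIsogenyLayerProofs`.
-/

noncomputable section

open scoped Classical NNReal Pointwise
open NumberField IsDedekindDomain Polynomial

universe u

/-! ## Generic algebra -/

namespace Literature.NumberTheory.EllipticCurves

section Field

variable {k : Type*} [Field k]

/-- **The abscissa of a singular point of a Weierstrass cubic is a root of a fixed nonzero
polynomial of degree `≤ 3`**: `4·F(x, y) = (2y + a₁x + a₃)² - D(x)` with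
`D = (a₁X + a₃)² + 4(X³ + a₂X² + a₄X + a₆)`, so `F = ∂F/∂y = 0` forces `D(x) = 0`; and if `D` is
the zero polynomial then `2 = a₁ = a₃ = 0` and `∂F/∂x = x² + a₄`. [cite: SilvermanAEC2009, III.1] -/
theorem exists_polynomial_of_not_nonsingular (V : WeierstrassCurve k) :
    ∃ D : k[X], D ≠ 0 ∧ D.natDegree ≤ 3 ∧ ∀ x y : k, V.toAffine.Equation x y →
      ¬ V.toAffine.Nonsingular x y → D.IsRoot x := by
  let D : k[X] := C 4 * X ^ 3 + C (V.a₁ ^ 2 + 4 * V.a₂) * X ^ 2 + C (2 * V.a₁ * V.a₃ + 4 * V.a₄) * X +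
    C (V.a₃ ^ 2 + 4 * V.a₆)
  have hDeval : ∀ x, D.eval x = (V.a₁ * x + V.a₃) ^ 2 + 4 * (x ^ 3 + V.a₂ * x ^ 2 + V.a₄ * x + V.a₆) := by
    intro x; simp only [D, eval_add, eval_mul, eval_C, eval_pow, eval_X]; ring
  have hDdeg : D.natDegree ≤ 3 := by
    refine (natDegree_add_le _ _).trans (max_le ((natDegree_add_le _ _).trans (max_le
      ((natDegree_add_le _ _).trans (max_le ?_ ?_)) ?_)) ?_)
    · exact (natDegree_C_mul_le _ _).trans (natDegree_pow_le_of_le 3 natDegree_X_le)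
    · exact (natDegree_C_mul_le _ _).trans ((natDegree_pow_le_of_le 2 natDegree_X_le).trans (by norm_num))
    · exact (natDegree_C_mul_le _ _).trans (natDegree_X_le.trans (by norm_num))
    · exact (natDegree_C _).trans_le (Nat.zero_le 3)
  -- singular points: both partial derivatives vanish
  have hsing : ∀ x y : k, V.toAffine.Equation x y → ¬ V.toAffine.Nonsingular x y →
      V.toAffine.a₁ * y - (3 * x ^ 2 + 2 * V.toAffine.a₂ * x + V.toAffine.a₄) = 0 ∧
        2 * y + V.toAffine.a₁ * x + V.toAffine.a₃ = 0 := by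
    intro x y he hns
    simp only [WeierstrassCurve.Affine.nonsingular_iff', not_and, not_or, not_not] at hns
    exact hns he
  by_cases hD : D = 0
  · -- then `4 = 0`, `a₁ = a₃ = 0`, and `∂F/∂x = x² + a₄`
    have hc3 : (4 : k) = 0 := by
      have := congrArg (fun p : k[X] ↦ p.coeff 3) hD
      simp only [D, coeff_add, coeff_C_mul, coeff_X_pow, coeff_X, coeff_C, coeff_zero] at this
      norm_num at this
      exact this
    have h2 : (2 : k) = 0 := by
      have : (2 : k) * 2 = 0 := by rw [← hc3]; norm_num
      exact (mul_self_eq_zero.mp this)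
    have hc2 : V.a₁ ^ 2 + 4 * V.a₂ = 0 := by
      have := congrArg (fun p : k[X] ↦ p.coeff 2) hD
      simp only [D, coeff_add, coeff_C_mul, coeff_X_pow, coeff_X, coeff_C, coeff_zero] at this
      norm_num at this
      exact this
    have hc0 : V.a₃ ^ 2 + 4 * V.a₆ = 0 := by
      have := congrArg (fun p : k[X] ↦ p.coeff 0) hD
      simp only [D, coeff_add, coeff_C_mul, coeff_X_pow, coeff_X, coeff_C, coeff_zero] at this
      norm_num at this
      exact this
    have ha₁ : V.a₁ = 0 := by
      have : V.a₁ ^ 2 = 0 := by rw [← hc2, hc3, zero_mul, add_zero]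
      exact pow_eq_zero_iff two_ne_zero |>.mp this
    have ha₃ : V.a₃ = 0 := by
      have : V.a₃ ^ 2 = 0 := by rw [← hc0, hc3, zero_mul, add_zero]
      exact pow_eq_zero_iff two_ne_zero |>.mp this
    refine ⟨X ^ 2 + C V.a₄, ?_, ?_, fun x y he hns ↦ ?_⟩
    · exact (monic_X_pow_add_C V.a₄ two_ne_zero).ne_zero
    · rw [natDegree_X_pow_add_C]; norm_num
    · obtain ⟨hx, -⟩ := hsing x y he hns
      have h3 : (3 : k) = 1 := by rw [show (3 : k) = 1 + 2 by norm_num, h2, add_zero]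
      rw [IsRoot.def, eval_add, eval_pow, eval_X, eval_C]
      have : V.toAffine.a₁ = V.a₁ := rfl
      rw [this, ha₁, zero_mul, zero_sub, neg_eq_zero, h3, one_mul, show (2 : k) * V.toAffine.a₂ * x = 0 by
        rw [h2, zero_mul, zero_mul], add_zero] at hx
      exact hx
  · refine ⟨D, hD, hDdeg, fun x y he hns ↦ ?_⟩
    obtain ⟨-, hy⟩ := hsing x y he hns
    rw [WeierstrassCurve.Affine.equation_iff'] at he
    rw [IsRoot.def, hDeval]
    have : V.toAffine.a₁ = V.a₁ ∧ V.toAffine.a₂ = V.a₂ ∧ V.toAffine.a₃ = V.a₃ ∧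
      V.toAffine.a₄ = V.a₄ ∧ V.toAffine.a₆ = V.a₆ := ⟨rfl, rfl, rfl, rfl, rfl⟩
    obtain ⟨e1, e2, e3, e4, e6⟩ := this
    rw [e1, e2, e3, e4, e6] at he; rw [e1, e3] at hy
    linear_combination (2 * y + V.a₁ * x + V.a₃) * hy - 4 * he

/-- **Roots of a quadratic over `𝔽_Q` lie in `𝔽_{Q²}`**: if `Q` is a power of the exponential
characteristic, `β^Q = β`, `γ^Q = γ` and `y² + βy - γ = 0`, then `(y^Q)^Q = y` (the `Q`-power
Frobenius permutes the two roots `y, -β - y`). [folklore] -/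
theorem pow_pow_eq_self_of_quadratic (p : ℕ) [ExpChar k p] (e : ℕ) {β γ y : k}
    (hβ : β ^ p ^ e = β) (hγ : γ ^ p ^ e = γ) (hy : y ^ 2 + β * y - γ = 0) :
    (y ^ p ^ e) ^ p ^ e = y := by
  -- the Frobenius `u ↦ u^Q` is a ring homomorphism fixing `β, γ`
  let Fr : k →+* k := iterateFrobenius k p e
  have hFr : ∀ u : k, Fr u = u ^ p ^ e := fun u ↦ iterateFrobenius_def ..
  have hroot : ∀ u : k, u ^ 2 + β * u - γ = 0 → (u ^ p ^ e) ^ 2 + β * u ^ p ^ e - γ = 0 := by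
    intro u hu
    have := congrArg Fr hu
    rw [map_sub, map_add, map_mul, map_pow, map_zero, hFr, hFr, hFr, hβ, hγ] at this
    exact this
  have hdich : ∀ u : k, u ^ 2 + β * u - γ = 0 → u = y ∨ u = -β - y := by
    intro u hu
    have h0 : (u - y) * (u - (-β - y)) = 0 := by linear_combination hu - hy
    rcases mul_eq_zero.mp h0 with h | h
    · exact Or.inl (sub_eq_zero.mp h)
    · exact Or.inr (sub_eq_zero.mp h)
  rcases hdich _ (hroot y hy) with h | h
  · rw [h, h]
  · have hneg : (-β - y) ^ p ^ e = -β - y ^ p ^ e := by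
      rw [← hFr, map_sub, map_neg, hFr, hFr, hβ]
    rw [h, hneg, h]; ring

end Field

/-- **A root of a nonzero polynomial with coefficients in `ι(F)` lies in `ι(F)`** (`F`
algebraically closed; the coefficient condition is membership in `Polynomial.lifts ι`). [folklore] -/
theorem mem_range_of_eval_eq_zero_of_mem_lifts {F E : Type*} [Field F] [Field E] [IsAlgClosed F]
    (ι : F →+* E) {H : E[X]} (hH : H ≠ 0) (hc : H ∈ Polynomial.lifts ι) {y : E}
    (hy : H.eval y = 0) : y ∈ Set.range ι := by
  obtain ⟨p, hp⟩ := (Polynomial.mem_lifts H).mp hc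
  have hp0 : p ≠ 0 := by rintro rfl; rw [Polynomial.map_zero] at hp; exact hH hp.symm
  exact mem_range_of_isRoot_map ι hp0 (by rw [IsRoot.def, hp]; exact hy)

/-- `u^q = u ⇒ u^{qᵉ} = u`. [folklore] -/
theorem pow_pow_eq_self_of_pow_eq {M : Type*} [Monoid M] {u : M} {q : ℕ} (h : u ^ q = u) (e : ℕ) :
    u ^ q ^ e = u := by
  induction e with
  | zero => rw [pow_zero, pow_one]
  | succ e ih => rw [pow_succ, pow_mul, ih, h]

end Literature.NumberTheory.EllipticCurves

/-! ## The local setting -/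

namespace IsDedekindDomain.HeightOneSpectrum

open Literature.NumberTheory.EllipticCurves Literature.NumberTheory.GaloisRepresentations Field
  Literature.NumberTheory.EllipticCurves.FormalGroupChart

variable {K : Type u} [Field K] [NumberField K] {v : HeightOneSpectrum (𝓞 K)}
  {w : Valuation (AlgebraicClosure (v.adicCompletion K)) ℝ≥0}
  (hw : ∀ x, (w x : ℝ) = spectralNorm (v.adicCompletion K) (AlgebraicClosure (v.adicCompletion K)) x)
  {𝔐 : Ideal v.localAbsIntegers} (h𝔐 : 𝔐 ∈ v.localPrimesAbove)
  {F : absoluteGaloisGroup (v.adicCompletion K)}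
  (hF : IsArithFrobAt (v.adicCompletionIntegers K) F 𝔐)
  {r : w.integer →+* AlgebraicClosure (IsLocalRing.ResidueField (v.adicCompletionIntegers K))}
  (hr : ∀ a : w.integer, r a = 0 ↔ w (a : AlgebraicClosure (v.adicCompletion K)) < 1)
  (hrF : ∀ (z : w.integer) (h : w (F • (z : AlgebraicClosure (v.adicCompletion K))) ≤ 1),
    r ⟨F • (z : AlgebraicClosure (v.adicCompletion K)), h⟩ =
      r z ^ Nat.card (IsLocalRing.ResidueField (v.adicCompletionIntegers K)))
  {n : ℕ} (hn : n ≠ 0) {ζ : AlgebraicClosure (v.adicCompletion K)}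
  (hζ : IsPrimitiveRoot ζ (Nat.card (IsLocalRing.ResidueField (v.adicCompletionIntegers K)) ^ n - 1))
  (W : WeierstrassCurve K)
  (ι : AlgebraicClosure K →ₐ[K] AlgebraicClosure (v.adicCompletion K))

/-- `K_v`. -/
local notation3 "𝕂" => v.adicCompletion K
/-- `K̄_v`. -/
local notation3 "𝕃" => AlgebraicClosure (v.adicCompletion K)
/-- `k̄_v`. -/
local notation3 "𝕜" => AlgebraicClosure (IsLocalRing.ResidueField (v.adicCompletionIntegers K))
/-- `q = #k_v`. -/
local notation3 "𝔮" => Nat.card (IsLocalRing.ResidueField (v.adicCompletionIntegers K))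
/-- `X ⊗ K̄_v` for `X = Y ⊗ K_v`. -/
local notation3 "V[" Y "]" =>
  WeierstrassCurve.baseChange (WeierstrassCurve.baseChange Y (v.adicCompletion K))
    (AlgebraicClosure (v.adicCompletion K))
/-- The layer points `E(K_n) ≤ X(K̄_v)`. -/
local notation3 "Rg[" Y "]" => (WeierstrassCurve.Affine.Point.map
  (W' := WeierstrassCurve.baseChange Y (v.adicCompletion K))
  (IntermediateField.val (IntermediateField.adjoin (v.adicCompletion K) {ζ}))).range
/-- The transport `ι_* : E(K̄) →+ X(K̄_v)`. -/
local notation3 "ι⁎[" Y "]" => AddMonoidHom.comp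
  (WeierstrassCurve.Affine.Point.congrEquiv
    (WeierstrassCurve.baseChange_baseChange_adicCompletion Y v).symm).toAddMonoidHom
  (pointsMapOfEmb Y ι)

/-! ## Algebraic Teichmüller representatives -/

/-- A root of unity of `K̄_v` is algebraic: `ζ ∈ ι(K̄)`. [folklore] -/
theorem mem_range_emb_of_pow_eq_one {m : ℕ} (hm0 : m ≠ 0) {t : 𝕃} (ht : t ^ m = 1) :
    t ∈ Set.range ι := by
  have hp : (X ^ m - 1 : (AlgebraicClosure K)[X]) ≠ 0 :=
    (monic_X_pow_sub_C (1 : AlgebraicClosure K) hm0).ne_zero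
  refine mem_range_of_isRoot_map (ι : AlgebraicClosure K →+* 𝕃) hp ?_
  rw [Polynomial.map_sub, Polynomial.map_pow, map_X, Polynomial.map_one, IsRoot.def, eval_sub,
    eval_pow, eval_X, eval_one, ht, sub_self]

include hw hr hn hζ in
/-- **Algebraic Teichmüller lift**: every `x̄ ∈ k̄_v` with `x̄^{qⁿ} = x̄` is the residue of `0`
or of a power of `ζ`: an element of `K_n ∩ ι(K̄)` of valuation `≤ 1`
(`exists_residue_eq_of_pow_eq` with the witness kept explicit).
[cite: SerreLocalFields1979, Ch. II §4 Prop. 8] -/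
theorem exists_algebraic_residue_eq_of_pow_eq {x : 𝕜} (hx : x ^ 𝔮 ^ n = x) :
    ∃ t : 𝕃, t ∈ IntermediateField.adjoin 𝕂 {ζ} ∧ t ∈ Set.range ι ∧
      ∃ h : w t ≤ 1, r ⟨t, h⟩ = x := by
  have h1 : w ζ ≤ 1 := spectralValuation_le_one_of_isPrimitiveRoot hn hζ
  have hprim := isPrimitiveRoot_residue hw hr hn hζ h1
  have hm0 : 𝔮 ^ n - 1 ≠ 0 := residueCard_pow_sub_one_ne_zero (v := v) hn
  have hm1 : 𝔮 ^ n - 1 + 1 = 𝔮 ^ n := Nat.sub_add_cancel (Nat.one_le_pow n _ Nat.card_pos)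
  have hx' : x ^ (𝔮 ^ n - 1 + 1) = x := by rw [hm1]; exact hx
  have hmem := mem_insert_zero_image_pow_of_pow_eq hprim hm0 hx'
  have hζalg : ζ ∈ Set.range ι := mem_range_emb_of_pow_eq_one ι hm0 hζ.pow_eq_one
  rcases Finset.mem_insert.mp hmem with rfl | hmem
  · exact ⟨0, zero_mem _, ⟨0, map_zero _⟩, ⟨by rw [map_zero]; exact zero_le_one, by
      rw [← map_zero r]; congr 1⟩⟩
  · obtain ⟨i, -, rfl⟩ := Finset.mem_image.mp hmem
    obtain ⟨z₀, hz₀⟩ := hζalg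
    refine ⟨ζ ^ i, pow_mem (IntermediateField.mem_adjoin_simple_self _ ζ) i,
      ⟨z₀ ^ i, by rw [map_pow, hz₀]⟩, ⟨by rw [map_pow]; exact pow_le_one₀ zero_le h1, ?_⟩⟩
    rw [← map_pow r]
    congr 1

include hrF in
/-- Residues of elements of `K_v` are fixed by the `q`-power map (`F` fixes `K_v`).
[folklore] -/
theorem residue_algebraMap_pow_card {a : 𝕂} (h : w (algebraMap 𝕂 𝕃 a) ≤ 1) :
    r ⟨algebraMap 𝕂 𝕃 a, h⟩ ^ 𝔮 = r ⟨algebraMap 𝕂 𝕃 a, h⟩ := by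
  have hF1 : w (F • algebraMap 𝕂 𝕃 a) ≤ 1 := by rw [smul_algebraMap]; exact h
  rw [← hrF ⟨_, h⟩ hF1]
  congr 1
  exact Subtype.ext (smul_algebraMap F a)

/-- The coefficients of `X ⊗ K̄_v` (`X = W ⊗ K_v`) are algebraic: they lie in `ι(K̄)`. [folklore] -/
theorem coeff_mem_range_emb :
    (V[W]).a₁ ∈ Set.range ι ∧ (V[W]).a₂ ∈ Set.range ι ∧ (V[W]).a₃ ∈ Set.range ι ∧
      (V[W]).a₄ ∈ Set.range ι ∧ (V[W]).a₆ ∈ Set.range ι := by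
  have key : ∀ b : K, algebraMap 𝕂 𝕃 (algebraMap K 𝕂 b) ∈ Set.range ι := fun b ↦
    ⟨algebraMap K (AlgebraicClosure K) b, by
      rw [AlgHom.commutes, IsScalarTower.algebraMap_apply K 𝕂 𝕃]⟩
  exact ⟨key W.a₁, key W.a₂, key W.a₃, key W.a₄, key W.a₆⟩

/-- The coefficients of `X ⊗ K̄_v` come from `K_v`. [folklore] -/
theorem coeff_eq_algebraMap :
    (V[W]).a₁ = algebraMap 𝕂 𝕃 (W.baseChange 𝕂).a₁ ∧ (V[W]).a₂ = algebraMap 𝕂 𝕃 (W.baseChange 𝕂).a₂ ∧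
      (V[W]).a₃ = algebraMap 𝕂 𝕃 (W.baseChange 𝕂).a₃ ∧ (V[W]).a₄ = algebraMap 𝕂 𝕃 (W.baseChange 𝕂).a₄ ∧
      (V[W]).a₆ = algebraMap 𝕂 𝕃 (W.baseChange 𝕂).a₆ :=
  ⟨rfl, rfl, rfl, rfl, rfl⟩

/-- A point of `X(K̄_v)` with both coordinates in `K_n` is a layer point. [folklore] -/
theorem some_mem_range_map {x y : 𝕃} (h : (V[W]).toAffine.Nonsingular x y)
    (hx : x ∈ IntermediateField.adjoin 𝕂 {ζ}) (hy : y ∈ IntermediateField.adjoin 𝕂 {ζ}) :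
    (.some x y h : (V[W]).toAffine.Point) ∈ Rg[W] := by
  have h' : ((W.baseChange 𝕂).baseChange (IntermediateField.adjoin 𝕂 {ζ})).toAffine.Nonsingular
      ⟨x, hx⟩ ⟨y, hy⟩ :=
    (WeierstrassCurve.Affine.baseChange_nonsingular (W := W.baseChange 𝕂)
      (f := IntermediateField.val (IntermediateField.adjoin 𝕂 {ζ})) Subtype.val_injective
      ⟨x, hx⟩ ⟨y, hy⟩).mp h
  exact ⟨.some ⟨x, hx⟩ ⟨y, hy⟩ h', by rw [WeierstrassCurve.Affine.Point.map_some]; rfl⟩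

/-! ## Lifting nonsingular `𝔽_{qⁿ}`-points of the reduction to ALGEBRAIC layer points -/

include hw hr hn hζ in
/-- **Algebraic lift of an `𝔽_{qⁿ}`-point of the reduced curve** (the tree's
`exists_lift_point_of_pow_eq`, Silverman *AEC* VII.2.1, with algebraicity tracked): for a
nonsingular affine point `(x̄, ȳ)` of the reduction of `X ⊗ K̄_v` (`X = W ⊗ K_v`) with
`x̄^{qⁿ} = x̄`, `ȳ^{qⁿ} = ȳ` there are `x, y ∈ 𝒪_w ∩ K_n ∩ ι(K̄)` on `X` with residues `x̄, ȳ`: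
one coordinate is an algebraic Teichmüller representative, the other a root (Hensel with descent,
`exists_root_mem_adjoin_of_residue`) of a polynomial with algebraic coefficients.
[cite: SilvermanAEC2009, Prop. VII.2.1 (proof)] -/
theorem exists_algebraic_lift_point [hV : (V[W]).IsIntegral w.integer] {xb yb : 𝕜}
    (hxb : xb ^ 𝔮 ^ n = xb) (hyb : yb ^ 𝔮 ^ n = yb)
    (hns : (reduceCurve r (V[W])).toAffine.Nonsingular xb yb) :
    ∃ x y : 𝕃, x ∈ IntermediateField.adjoin 𝕂 {ζ} ∧ y ∈ IntermediateField.adjoin 𝕂 {ζ} ∧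
      x ∈ Set.range ι ∧ y ∈ Set.range ι ∧
      ∃ (hx1 : w x ≤ 1) (hy1 : w y ≤ 1),
        (V[W]).toAffine.Equation x y ∧ r ⟨x, hx1⟩ = xb ∧ r ⟨y, hy1⟩ = yb := by
  -- notation
  let E := v.adicCompletion K
  let L := AlgebraicClosure (v.adicCompletion K)
  set V : WeierstrassCurve L := V[W] with hVdef
  have hm0 := residueCard_pow_sub_one_ne_zero (v := v) hn
  -- the range of `ι` as a subalgebra
  have hrange : ∀ z : L, z ∈ Set.range ι ↔ z ∈ ι.range := fun z ↦ by
    rw [← AlgHom.coe_range]; rfl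
  -- algebraic Teichmüller lifts of the coordinates
  obtain ⟨t₁, ht₁K, ht₁alg, ht₁1, hrt₁⟩ := exists_algebraic_residue_eq_of_pow_eq hw hr hn hζ ι hxb
  obtain ⟨t₂, ht₂K, ht₂alg, ht₂1, hrt₂⟩ := exists_algebraic_residue_eq_of_pow_eq hw hr hn hζ ι hyb
  -- the coefficients and their residues
  have ha₁ : w V.a₁ ≤ 1 := val_a₁_le_one
  have ha₂ : w V.a₂ ≤ 1 := val_a₂_le_one
  have ha₃ : w V.a₃ ≤ 1 := val_a₃_le_one
  have ha₄ : w V.a₄ ≤ 1 := val_a₄_le_one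
  have ha₆ : w V.a₆ ≤ 1 := val_a₆_le_one
  obtain ⟨ha₁alg, ha₂alg, ha₃alg, ha₄alg, ha₆alg⟩ := coeff_mem_range_emb (v := v) W ι
  let A₁ : w.integer := ⟨V.a₁, ha₁⟩
  let A₂ : w.integer := ⟨V.a₂, ha₂⟩
  let A₃ : w.integer := ⟨V.a₃, ha₃⟩
  let A₄ : w.integer := ⟨V.a₄, ha₄⟩
  let A₆ : w.integer := ⟨V.a₆, ha₆⟩
  let T₁ : w.integer := ⟨t₁, ht₁1⟩
  let T₂ : w.integer := ⟨t₂, ht₂1⟩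
  have hc₁ : (reduceCurve r V).a₁ = r A₁ := reduceFun_of_le r ha₁
  have hc₂ : (reduceCurve r V).a₂ = r A₂ := reduceFun_of_le r ha₂
  have hc₃ : (reduceCurve r V).a₃ = r A₃ := reduceFun_of_le r ha₃
  have hc₄ : (reduceCurve r V).a₄ = r A₄ := reduceFun_of_le r ha₄
  have hc₆ : (reduceCurve r V).a₆ = r A₆ := reduceFun_of_le r ha₆
  -- the reduced point: equation and nonsingularity
  rw [WeierstrassCurve.Affine.nonsingular_iff', WeierstrassCurve.Affine.equation_iff'] at hns
  simp only [hc₁, hc₂, hc₃, hc₄, hc₆] at hns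
  obtain ⟨heqb, hpart⟩ := hns
  rw [← hrt₁, ← hrt₂] at heqb hpart
  -- the Galois action on the data
  have hσa : ∀ (σ : absoluteGaloisGroup E) (a : E), σ • (algebraMap E L a) = algebraMap E L a :=
    fun σ a ↦ smul_algebraMap σ a
  obtain ⟨e₁, e₂, e₃, e₄, e₆⟩ := coeff_eq_algebraMap (v := v) W
  have hfix : ∀ σ : absoluteGaloisGroup E, σ • ζ = ζ →
      σ • t₁ = t₁ ∧ σ • t₂ = t₂ ∧ σ • V.a₁ = V.a₁ ∧ σ • V.a₂ = V.a₂ ∧ σ • V.a₃ = V.a₃ ∧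
        σ • V.a₄ = V.a₄ ∧ σ • V.a₆ = V.a₆ := fun σ hσ ↦
    ⟨(forall_smul_eq_self_iff_smul_eq hm0 hζ.pow_eq_one σ).mpr hσ t₁ ht₁K,
     (forall_smul_eq_self_iff_smul_eq hm0 hζ.pow_eq_one σ).mpr hσ t₂ ht₂K,
     by rw [hVdef, e₁]; exact hσa σ _, by rw [hVdef, e₂]; exact hσa σ _,
     by rw [hVdef, e₃]; exact hσa σ _, by rw [hVdef, e₄]; exact hσa σ _,
     by rw [hVdef, e₆]; exact hσa σ _⟩
  -- membership in `ι(K̄)` is closed under the ring operations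
  have hιK : ∀ {a b : L}, a ∈ Set.range ι → b ∈ Set.range ι → a + b ∈ Set.range ι ∧
      a * b ∈ Set.range ι ∧ a - b ∈ Set.range ι ∧ -a ∈ Set.range ι := by
    intro a b ha hb
    rw [hrange] at ha hb ⊢; rw [hrange, hrange, hrange]
    exact ⟨add_mem ha hb, mul_mem ha hb, sub_mem ha hb, neg_mem ha⟩
  have hιpow : ∀ {a : L}, a ∈ Set.range ι → ∀ k : ℕ, a ^ k ∈ Set.range ι := by
    intro a ha k; rw [hrange] at ha ⊢; exact pow_mem ha k
  by_cases hY : 2 * r T₂ + r A₁ * r T₁ + r A₃ ≠ 0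
  · /- Case `∂/∂y ≠ 0`: solve the Weierstrass polynomial in `y` at `x = t₁`. -/
    have hB1 : w (V.a₁ * t₁ + V.a₃) ≤ 1 := by
      refine (Valuation.map_add w _ _).trans (max_le ?_ ha₃)
      rw [map_mul]; exact mul_le_one' ha₁ ht₁1
    have hC1 : w (-(t₁ ^ 3 + V.a₂ * t₁ ^ 2 + V.a₄ * t₁ + V.a₆)) ≤ 1 := by
      rw [Valuation.map_neg]
      refine (Valuation.map_add w _ _).trans (max_le ((Valuation.map_add w _ _).trans (max_le
        ((Valuation.map_add w _ _).trans (max_le ?_ ?_)) ?_)) ha₆)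
      · rw [map_pow]; exact pow_le_one₀ zero_le ht₁1
      · rw [map_mul, map_pow]; exact mul_le_one' ha₂ (pow_le_one₀ zero_le ht₁1)
      · rw [map_mul]; exact mul_le_one' ha₄ ht₁1
    let B : w.integer := ⟨V.a₁ * t₁ + V.a₃, hB1⟩
    let Cc : w.integer := ⟨-(t₁ ^ 3 + V.a₂ * t₁ ^ 2 + V.a₄ * t₁ + V.a₆), hC1⟩
    let f : w.integer[X] := C 1 * Polynomial.X ^ 2 + C B * Polynomial.X + C Cc
    set H : L[X] := f.map (algebraMap w.integer L) with hHdef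
    have hHcoeff : ∀ i, w (H.coeff i) ≤ 1 := fun i ↦ by rw [hHdef, coeff_map]; exact (f.coeff i).2
    have hφB : algebraMap w.integer L B = V.a₁ * t₁ + V.a₃ := rfl
    have hφC : algebraMap w.integer L Cc = -(t₁ ^ 3 + V.a₂ * t₁ ^ 2 + V.a₄ * t₁ + V.a₆) := rfl
    have hHexp : H = Polynomial.X ^ 2 + C (V.a₁ * t₁ + V.a₃) * Polynomial.X +
        C (-(t₁ ^ 3 + V.a₂ * t₁ ^ 2 + V.a₄ * t₁ + V.a₆)) := by
      rw [hHdef]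
      simp only [f, Polynomial.map_add, Polynomial.map_mul, Polynomial.map_pow, map_C, map_X,
        map_one, one_mul, hφB, hφC]
    have hHeval : ∀ s : L, H.eval s =
        s ^ 2 + (V.a₁ * t₁ + V.a₃) * s - (t₁ ^ 3 + V.a₂ * t₁ ^ 2 + V.a₄ * t₁ + V.a₆) := by
      intro s
      rw [hHexp, eval_add, eval_add, eval_pow, eval_X, eval_mul, eval_C, eval_X, eval_C]
      ring
    have hHder' : H.derivative = C 2 * Polynomial.X + C (V.a₁ * t₁ + V.a₃) := by
      rw [hHexp, derivative_add, derivative_add, derivative_X_sq, derivative_C_mul_X, derivative_C,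
        add_zero]
    have hHder : ∀ s : L, H.derivative.eval s = 2 * s + (V.a₁ * t₁ + V.a₃) := by
      intro s
      rw [hHder', eval_add, eval_mul, eval_C, eval_X, eval_C]
    have hHunit : ∃ i, w (H.coeff i) = 1 := ⟨2, by
      rw [hHexp]
      simp only [coeff_add, coeff_C_mul, coeff_X_pow, coeff_X, coeff_C]
      norm_num⟩
    -- value and derivative at `t₂`
    have hval : (⟨H.eval t₂, val_eval_le_one w hHcoeff ht₂1⟩ : w.integer) =
        T₂ ^ 2 + (A₁ * T₁ + A₃) * T₂ - (T₁ ^ 3 + A₂ * T₁ ^ 2 + A₄ * T₁ + A₆) :=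
      Subtype.ext (by
        change H.eval t₂ = ((T₂ ^ 2 + (A₁ * T₁ + A₃) * T₂ - (T₁ ^ 3 + A₂ * T₁ ^ 2 + A₄ * T₁ + A₆) :
          w.integer) : L)
        rw [hHeval]; push_cast; rfl)
    have h0 : w (H.eval t₂) < 1 := by
      have : r ⟨H.eval t₂, val_eval_le_one w hHcoeff ht₂1⟩ = 0 := by
        rw [hval]; simp only [map_add, map_sub, map_mul, map_pow]
        linear_combination heqb
      exact (hr _).mp this
    have hder1 : w (H.derivative.eval t₂) ≤ 1 :=
      val_eval_le_one w (val_coeff_derivative_le w hHcoeff) ht₂1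
    have hderval : (⟨H.derivative.eval t₂, hder1⟩ : w.integer) = 2 * T₂ + (A₁ * T₁ + A₃) :=
      Subtype.ext (by
        change H.derivative.eval t₂ = ((2 * T₂ + (A₁ * T₁ + A₃) : w.integer) : L)
        rw [hHder]; push_cast; rfl)
    have hd : w (H.derivative.eval t₂) = 1 := by
      refine spectralValuation_eq_one_of_residue_ne_zero hr hder1 ?_
      rw [hderval]; simp only [map_add, map_mul, map_ofNat]
      exact fun h ↦ hY (by linear_combination h)
    have hHσ : ∀ σ : absoluteGaloisGroup E, σ • ζ = ζ → ∀ s : L, H.eval (σ • s) = σ • H.eval s := by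
      intro σ hσ s
      obtain ⟨h1, -, h3, h4, h5, h6, h7⟩ := hfix σ hσ
      rw [hHeval, hHeval]
      simp only [smul_sub, smul_add, smul_mul', smul_pow', h1, h3, h4, h5, h6, h7]
    obtain ⟨y, hyK, hy1, hyT, hyroot⟩ :=
      exists_root_mem_adjoin_of_residue hw hm0 hζ.pow_eq_one hHcoeff hHunit ht₂K ht₂1 h0 hd hHσ
    -- algebraicity of `y`: `H` has algebraic coefficients
    have hH0 : H ≠ 0 := by
      obtain ⟨i, hi⟩ := hHunit
      intro h; rw [h, coeff_zero, map_zero] at hi; exact zero_ne_one hi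
    have hHlifts : H ∈ Polynomial.lifts (ι : AlgebraicClosure K →+* L) := by
      rw [hHexp]
      refine add_mem (add_mem (pow_mem (Polynomial.X_mem_lifts _) 2)
        (mul_mem (Polynomial.C'_mem_lifts ?_) (Polynomial.X_mem_lifts _))) (Polynomial.C'_mem_lifts ?_)
      · exact (hιK (hιK ha₁alg ht₁alg).2.1 ha₃alg).1
      · exact (fun h ↦ (hιK h h).2.2.2) (hιK (hιK (hιK (hιpow ht₁alg 3)
          (hιK ha₂alg (hιpow ht₁alg 2)).2.1).1 (hιK ha₄alg ht₁alg).2.1).1 ha₆alg).1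
    have hyalg : y ∈ Set.range ι :=
      mem_range_of_eval_eq_zero_of_mem_lifts (ι : AlgebraicClosure K →+* L) hH0 hHlifts hyroot
    refine ⟨t₁, y, ht₁K, hyK, ht₁alg, hyalg, ht₁1, hy1, ?_, hrt₁, ?_⟩
    · rw [WeierstrassCurve.Affine.equation_iff']
      rw [hHeval] at hyroot
      linear_combination hyroot
    · rw [← hrt₂]; exact (residue_eq_residue_iff hr ⟨y, hy1⟩ T₂).mpr hyT
  · /- Case `∂/∂y = 0`, hence `∂/∂x ≠ 0`: solve the monic cubic in `x` at `y = t₂`. -/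
    have hY' : 2 * r T₂ + r A₁ * r T₁ + r A₃ = 0 := not_ne_iff.mp hY
    have hXne : r A₁ * r T₂ - (3 * r T₁ ^ 2 + 2 * r A₂ * r T₁ + r A₄) ≠ 0 := by
      rcases hpart with h | h
      · exact h
      · exact absurd hY' h
    have hB1 : w (V.a₄ - V.a₁ * t₂) ≤ 1 := by
      refine (Valuation.map_sub w _ _).trans (max_le ha₄ ?_)
      rw [map_mul]; exact mul_le_one' ha₁ ht₂1
    have hC1 : w (V.a₆ - t₂ ^ 2 - V.a₃ * t₂) ≤ 1 := by
      refine (Valuation.map_sub w _ _).trans (max_le ((Valuation.map_sub w _ _).trans (max_le ha₆ ?_)) ?_)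
      · rw [map_pow]; exact pow_le_one₀ zero_le ht₂1
      · rw [map_mul]; exact mul_le_one' ha₃ ht₂1
    let B : w.integer := ⟨V.a₄ - V.a₁ * t₂, hB1⟩
    let Cc : w.integer := ⟨V.a₆ - t₂ ^ 2 - V.a₃ * t₂, hC1⟩
    let f : w.integer[X] := C 1 * Polynomial.X ^ 3 + C A₂ * Polynomial.X ^ 2 + C B * Polynomial.X + C Cc
    set H : L[X] := f.map (algebraMap w.integer L) with hHdef
    have hHcoeff : ∀ i, w (H.coeff i) ≤ 1 := fun i ↦ by rw [hHdef, coeff_map]; exact (f.coeff i).2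
    have hφA₂ : algebraMap w.integer L A₂ = V.a₂ := rfl
    have hφB : algebraMap w.integer L B = V.a₄ - V.a₁ * t₂ := rfl
    have hφC : algebraMap w.integer L Cc = V.a₆ - t₂ ^ 2 - V.a₃ * t₂ := rfl
    have hHexp : H = Polynomial.X ^ 3 + C V.a₂ * Polynomial.X ^ 2 +
        C (V.a₄ - V.a₁ * t₂) * Polynomial.X + C (V.a₆ - t₂ ^ 2 - V.a₃ * t₂) := by
      rw [hHdef]
      simp only [f, Polynomial.map_add, Polynomial.map_mul, Polynomial.map_pow, map_C, map_X,
        map_one, one_mul, hφA₂, hφB, hφC]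
    have hHeval : ∀ s : L, H.eval s =
        s ^ 3 + V.a₂ * s ^ 2 + (V.a₄ - V.a₁ * t₂) * s + (V.a₆ - t₂ ^ 2 - V.a₃ * t₂) := by
      intro s
      rw [hHexp, eval_add, eval_add, eval_add, eval_pow, eval_X, eval_mul, eval_C, eval_pow, eval_X,
        eval_mul, eval_C, eval_X, eval_C]
    have h3 : derivative (Polynomial.X ^ 3 : L[X]) = C 3 * Polynomial.X ^ 2 := by
      rw [derivative_X_pow]; norm_num
    have hHder' : H.derivative = C 3 * Polynomial.X ^ 2 + C (V.a₂ * 2) * Polynomial.X +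
        C (V.a₄ - V.a₁ * t₂) := by
      rw [hHexp, derivative_add, derivative_add, derivative_add, h3, derivative_C_mul_X_sq,
        derivative_C_mul_X, derivative_C, add_zero]
    have hHder : ∀ s : L, H.derivative.eval s = 3 * s ^ 2 + 2 * V.a₂ * s + (V.a₄ - V.a₁ * t₂) := by
      intro s
      rw [hHder', eval_add, eval_add, eval_mul, eval_C, eval_pow, eval_X, eval_mul, eval_C, eval_X,
        eval_C]
      ring
    have hHunit : ∃ i, w (H.coeff i) = 1 := ⟨3, by
      rw [hHexp]
      simp only [coeff_add, coeff_C_mul, coeff_X_pow, coeff_X, coeff_C]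
      norm_num⟩
    have hval : (⟨H.eval t₁, val_eval_le_one w hHcoeff ht₁1⟩ : w.integer) =
        T₁ ^ 3 + A₂ * T₁ ^ 2 + (A₄ - A₁ * T₂) * T₁ + (A₆ - T₂ ^ 2 - A₃ * T₂) :=
      Subtype.ext (by
        change H.eval t₁ = ((T₁ ^ 3 + A₂ * T₁ ^ 2 + (A₄ - A₁ * T₂) * T₁ + (A₆ - T₂ ^ 2 - A₃ * T₂) :
          w.integer) : L)
        rw [hHeval]; push_cast; rfl)
    have h0 : w (H.eval t₁) < 1 := by
      have : r ⟨H.eval t₁, val_eval_le_one w hHcoeff ht₁1⟩ = 0 := by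
        rw [hval]; simp only [map_add, map_sub, map_mul, map_pow]
        linear_combination (-1 : 𝕜) * heqb
      exact (hr _).mp this
    have hder1 : w (H.derivative.eval t₁) ≤ 1 :=
      val_eval_le_one w (val_coeff_derivative_le w hHcoeff) ht₁1
    have hderval : (⟨H.derivative.eval t₁, hder1⟩ : w.integer) =
        3 * T₁ ^ 2 + 2 * A₂ * T₁ + (A₄ - A₁ * T₂) :=
      Subtype.ext (by
        change H.derivative.eval t₁ = ((3 * T₁ ^ 2 + 2 * A₂ * T₁ + (A₄ - A₁ * T₂) : w.integer) : L)
        rw [hHder]; push_cast; rfl)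
    have hd : w (H.derivative.eval t₁) = 1 := by
      refine spectralValuation_eq_one_of_residue_ne_zero hr hder1 ?_
      rw [hderval]; simp only [map_add, map_sub, map_mul, map_pow, map_ofNat]
      exact fun h ↦ hXne (by linear_combination (-1 : 𝕜) * h)
    have hHσ : ∀ σ : absoluteGaloisGroup E, σ • ζ = ζ → ∀ s : L, H.eval (σ • s) = σ • H.eval s := by
      intro σ hσ s
      obtain ⟨-, h2, h3, h4, h5, h6, h7⟩ := hfix σ hσ
      rw [hHeval, hHeval]
      simp only [smul_sub, smul_add, smul_mul', smul_pow', h2, h3, h4, h5, h6, h7]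
    obtain ⟨x, hxK, hx1, hxT, hxroot⟩ :=
      exists_root_mem_adjoin_of_residue hw hm0 hζ.pow_eq_one hHcoeff hHunit ht₁K ht₁1 h0 hd hHσ
    -- algebraicity of `x`
    have hH0 : H ≠ 0 := by
      obtain ⟨i, hi⟩ := hHunit
      intro h; rw [h, coeff_zero, map_zero] at hi; exact zero_ne_one hi
    have hHlifts : H ∈ Polynomial.lifts (ι : AlgebraicClosure K →+* L) := by
      rw [hHexp]
      refine add_mem (add_mem (add_mem (pow_mem (Polynomial.X_mem_lifts _) 3)
        (mul_mem (Polynomial.C'_mem_lifts ha₂alg) (pow_mem (Polynomial.X_mem_lifts _) 2)))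
        (mul_mem (Polynomial.C'_mem_lifts ?_) (Polynomial.X_mem_lifts _))) (Polynomial.C'_mem_lifts ?_)
      · exact (hιK ha₄alg (hιK ha₁alg ht₂alg).2.1).2.2.1
      · exact (hιK (hιK ha₆alg (hιpow ht₂alg 2)).2.2.1 (hιK ha₃alg ht₂alg).2.1).2.2.1
    have hxalg : x ∈ Set.range ι :=
      mem_range_of_eval_eq_zero_of_mem_lifts (ι : AlgebraicClosure K →+* L) hH0 hHlifts hxroot
    refine ⟨x, t₂, hxK, ht₂K, hxalg, ht₂alg, hx1, ht₂1, ?_, ?_, hrt₂⟩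
    · rw [WeierstrassCurve.Affine.equation_iff']
      rw [hHeval] at hxroot
      linear_combination (-1 : L) * hxroot
    · rw [← hrt₁]; exact (residue_eq_residue_iff hr ⟨x, hx1⟩ T₁).mpr hxT

/-! ## Integral points with distinct `x̄` are inequivalent modulo `E₁` -/

include hr in
/-- **The chord criterion**: two `w`-integral points of `X(K̄_v)` with different residues
`x̄ ≠ x̄'` differ by a point OUTSIDE the kernel of reduction `E₁` (the chord has slope
`(y + y' + a₁x' + a₃)/(x - x')` with unit denominator, so `x(P - P')` is integral).
[cite: SilvermanAEC2009, Prop. VII.2.1 (proof: `E₀(K)` is a subgroup)] -/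
theorem not_sub_mem_kernel_of_residue_ne {Y : WeierstrassCurve K} [(V[Y]).IsIntegral w.integer]
    {x y x' y' : 𝕃} {h : (V[Y]).toAffine.Nonsingular x y} {h' : (V[Y]).toAffine.Nonsingular x' y'}
    (hx : w x ≤ 1) (hy : w y ≤ 1) (hx' : w x' ≤ 1) (hy' : w y' ≤ 1)
    (hne : r ⟨x, hx⟩ ≠ r ⟨x', hx'⟩) :
    (.some x y h : (V[Y]).toAffine.Point) - .some x' y' h' ∉ kernel w (V[Y]) := by
  have ha₁ : w (V[Y]).a₁ ≤ 1 := val_a₁_le_one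
  have ha₂ : w (V[Y]).a₂ ≤ 1 := val_a₂_le_one
  have ha₃ : w (V[Y]).a₃ ≤ 1 := val_a₃_le_one
  -- `|x - x'| = 1`
  have hxx1 : w (x - x') = 1 := by
    refine le_antisymm ((Valuation.map_sub w _ _).trans (max_le hx hx')) (not_lt.mp fun hlt ↦ hne ?_)
    exact (residue_eq_residue_iff hr ⟨x, hx⟩ ⟨x', hx'⟩).mpr hlt
  have hxne : x ≠ x' := fun he ↦ by rw [he, sub_self, map_zero] at hxx1; exact zero_ne_one hxx1
  rw [sub_eq_add_neg, WeierstrassCurve.Affine.Point.neg_some,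
    WeierstrassCurve.Affine.Point.add_of_X_ne hxne, some_mem_kernel_iff, not_lt]
  -- the slope is integral
  set Ls := (V[Y]).toAffine.slope x x' y ((V[Y]).toAffine.negY x' y') with hLs
  have hL1 : w Ls ≤ 1 := by
    rw [hLs, WeierstrassCurve.Affine.slope_of_X_ne hxne, map_div₀, hxx1, div_one]
    refine (Valuation.map_sub w _ _).trans (max_le hy ?_)
    rw [WeierstrassCurve.Affine.negY]
    refine (Valuation.map_sub w _ _).trans (max_le ((Valuation.map_sub w _ _).trans (max_le ?_ ?_)) ?_)
    · rw [Valuation.map_neg]; exact hy'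
    · rw [map_mul]; exact mul_le_one' ha₁ hx'
    · exact ha₃
  rw [WeierstrassCurve.Affine.addX]
  refine (Valuation.map_sub w _ _).trans (max_le ((Valuation.map_sub w _ _).trans (max_le
    ((Valuation.map_sub w _ _).trans (max_le ((Valuation.map_add w _ _).trans (max_le ?_ ?_)) ha₂)) hx)) hx')
  · rw [map_pow]; exact pow_le_one₀ zero_le hL1
  · rw [map_mul]; exact mul_le_one' ha₁ hL1

/-! ## The family of level zero -/

include hw hr hrF hn hζ in
/-- **`q^g - 3` algebraic points of `E(K_{2g})`, pairwise inequivalent modulo `E₁`.** For `W/K`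
elliptic with `W ⊗ K̄_v` `w`-integral and the layer `K_n`, `n = 2g`: there is a finite set `S` of
points of `E(K̄)` with `#S ≥ q^g - 3`, whose transports are layer points, and such that
`ι_*(P - P') ∉ E₁` for `P ≠ P'` in `S`. For each `x̄ ∈ 𝔽_{q^g} = {0} ∪ μ_{q^g-1}(k̄_v)` (`q^g`
values) off the `≤ 3` roots of the polynomial of `exists_polynomial_of_not_nonsingular`, a point
`(x̄, ȳ)` of the reduced curve is nonsingular with `ȳ ∈ 𝔽_{q^{2g}}`
(`pow_pow_eq_self_of_quadratic`), and lifts to an algebraic integral layer point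
(`exists_algebraic_lift_point`); distinct `x̄` give inequivalent points
(`not_sub_mem_kernel_of_residue_ne`). [cite: SilvermanAEC2009, Prop. VII.2.1] -/
theorem exists_levelZero_family [hV : (V[W]).IsIntegral w.integer] [W.IsElliptic] {g : ℕ}
    (hg : g ≠ 0) (hng : n = 2 * g) :
    ∃ S : Finset W.geomPoints, 𝔮 ^ g ≤ S.card + 3 ∧ (∀ P ∈ S, ι⁎[W] P ∈ Rg[W]) ∧
      ∀ P ∈ S, ∀ P' ∈ S, P ≠ P' → ι⁎[W] (P - P') ∉ kernel w (V[W]) := by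
  -- the residue field `k_v`, `q = p^f`, and the exponential characteristic of `k̄_v`
  haveI : Finite (IsLocalRing.ResidueField (v.adicCompletionIntegers K)) :=
    finite_residueField_adicCompletionIntegers K v
  letI : Fintype (IsLocalRing.ResidueField (v.adicCompletionIntegers K)) := Fintype.ofFinite _
  obtain ⟨p, hcharp, ⟨f, hpprime, hcard⟩⟩ :=
    FiniteField.card' (IsLocalRing.ResidueField (v.adicCompletionIntegers K))
  haveI : CharP 𝕜 p :=
    charP_of_injective_algebraMap (algebraMap (IsLocalRing.ResidueField (v.adicCompletionIntegers K))
      𝕜).injective p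
  haveI : ExpChar 𝕜 p := ExpChar.prime hpprime
  have hqf : 𝔮 = p ^ (f : ℕ) := by rw [Nat.card_eq_fintype_card, hcard]
  have hq1 : 1 < 𝔮 := Finite.one_lt_card
  have hq0 : 0 < 𝔮 := Nat.card_pos
  -- the primitive `(q^g - 1)`-th root of unity `ζ^(q^g + 1)` of the layer and its residue
  have hfac : 𝔮 ^ n - 1 = (𝔮 ^ g + 1) * (𝔮 ^ g - 1) := by
    rw [hng, pow_mul', ← Nat.sq_sub_sq, one_pow]
  have hm0 : 𝔮 ^ n - 1 ≠ 0 := residueCard_pow_sub_one_ne_zero (v := v) hn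
  have hmg0 : 𝔮 ^ g - 1 ≠ 0 := residueCard_pow_sub_one_ne_zero (v := v) hg
  have hζg : IsPrimitiveRoot (ζ ^ (𝔮 ^ g + 1)) (𝔮 ^ g - 1) := hζ.pow (Nat.pos_of_ne_zero hm0) hfac
  have hζ1 : w ζ ≤ 1 := spectralValuation_le_one_of_isPrimitiveRoot hn hζ
  have hζg1 : w (ζ ^ (𝔮 ^ g + 1)) ≤ 1 := spectralValuation_le_one_of_isPrimitiveRoot hg hζg
  have hprim := isPrimitiveRoot_residue hw hr hg hζg hζg1
  set ζb : 𝕜 := r ⟨ζ ^ (𝔮 ^ g + 1), hζg1⟩ with hζb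
  -- `𝔽_{q^g} ⊆ k̄_v`
  let Tg : Finset 𝕜 := insert (0 : 𝕜) ((Finset.range (𝔮 ^ g - 1)).image (fun i : ℕ ↦ ζb ^ i))
  have hTgcard : Tg.card = 𝔮 ^ g := by
    rw [card_insert_zero_image_pow hprim hmg0]; exact Nat.sub_add_cancel (Nat.one_le_pow g _ hq0)
  have hTgpow : ∀ x ∈ Tg, x ^ 𝔮 ^ g = x := fun x hx ↦ by
    have := pow_succ_eq_self_of_mem_insert_zero_image_pow hprim.pow_eq_one hx
    rwa [Nat.sub_add_cancel (Nat.one_le_pow g _ hq0)] at this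
  have hTgpow' : ∀ x ∈ Tg, x ^ 𝔮 ^ n = x := fun x hx ↦ by
    rw [hng, pow_mul', sq, pow_mul, hTgpow x hx, hTgpow x hx]
  -- the reduced curve, its coefficients, and the exceptional abscissae
  set Vt := reduceCurve r (V[W]) with hVt
  obtain ⟨D, hD0, hDdeg, hDroot⟩ := exists_polynomial_of_not_nonsingular Vt
  have hcoef : ∀ c : 𝕜, (c = Vt.a₁ ∨ c = Vt.a₂ ∨ c = Vt.a₃ ∨ c = Vt.a₄ ∨ c = Vt.a₆) → c ^ 𝔮 ^ g = c := by
    obtain ⟨e₁, e₂, e₃, e₄, e₆⟩ := coeff_eq_algebraMap (v := v) W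
    have key : ∀ (a : 𝕂) (ha : w (algebraMap 𝕂 𝕃 a) ≤ 1), reduceFun r (algebraMap 𝕂 𝕃 a) ^ 𝔮 ^ g =
        reduceFun r (algebraMap 𝕂 𝕃 a) := fun a ha ↦ by
      rw [reduceFun_of_le r ha]; exact pow_pow_eq_self_of_pow_eq (residue_algebraMap_pow_card hrF ha) g
    rintro c (rfl | rfl | rfl | rfl | rfl)
    · rw [hVt, reduceCurve_a₁, e₁]; exact key _ (e₁ ▸ val_a₁_le_one)
    · rw [hVt, reduceCurve_a₂, e₂]; exact key _ (e₂ ▸ val_a₂_le_one)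
    · rw [hVt, reduceCurve_a₃, e₃]; exact key _ (e₃ ▸ val_a₃_le_one)
    · rw [hVt, reduceCurve_a₄, e₄]; exact key _ (e₄ ▸ val_a₄_le_one)
    · rw [hVt, reduceCurve_a₆, e₆]; exact key _ (e₆ ▸ val_a₆_le_one)
  -- for each good `x̄`, an algebraic integral layer point with that residue
  have key : ∀ xb ∈ Tg \ D.roots.toFinset, ∃ P : W.geomPoints, ι⁎[W] P ∈ Rg[W] ∧
      ∃ (x y : 𝕃) (h : (V[W]).toAffine.Nonsingular x y) (hx1 : w x ≤ 1) (_ : w y ≤ 1),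
        ι⁎[W] P = .some x y h ∧ r ⟨x, hx1⟩ = xb := by
    intro xb hxb
    obtain ⟨hxT, hxD⟩ := Finset.mem_sdiff.mp hxb
    have hxD' : ¬ D.IsRoot xb := fun h ↦ hxD (Multiset.mem_toFinset.mpr ((mem_roots hD0).mpr h))
    -- a point of the reduced curve above `x̄`; it is nonsingular and defined over `𝔽_{q^{2g}}`
    obtain ⟨yb, hyb⟩ := WeierstrassCurve.exists_equation Vt xb
    have hns : Vt.toAffine.Nonsingular xb yb := by
      by_contra hns; exact hxD' (hDroot xb yb hyb hns)
    have hxpow : xb ^ 𝔮 ^ g = xb := hTgpow xb hxT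
    have hpq : p ^ ((f : ℕ) * g) = 𝔮 ^ g := by rw [pow_mul, hqf]
    let Fr : 𝕜 →+* 𝕜 := iterateFrobenius 𝕜 p ((f : ℕ) * g)
    have hFr : ∀ u : 𝕜, Fr u = u ^ 𝔮 ^ g := fun u ↦ by rw [iterateFrobenius_def, hpq]
    have hypow : yb ^ 𝔮 ^ n = yb := by
      have hβ : (Vt.a₁ * xb + Vt.a₃) ^ 𝔮 ^ g = Vt.a₁ * xb + Vt.a₃ := by
        rw [← hFr, map_add, map_mul, hFr, hFr, hFr, hxpow, hcoef _ (Or.inl rfl),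
          hcoef _ (Or.inr (Or.inr (Or.inl rfl)))]
      have hγ : (xb ^ 3 + Vt.a₂ * xb ^ 2 + Vt.a₄ * xb + Vt.a₆) ^ 𝔮 ^ g =
          xb ^ 3 + Vt.a₂ * xb ^ 2 + Vt.a₄ * xb + Vt.a₆ := by
        rw [← hFr]
        simp only [map_add, map_mul, map_pow]
        rw [hFr, hFr, hFr, hFr, hxpow, hcoef _ (Or.inr (Or.inl rfl)),
          hcoef _ (Or.inr (Or.inr (Or.inr (Or.inl rfl)))), hcoef _ (Or.inr (Or.inr (Or.inr (Or.inr rfl))))]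
      have he : yb ^ 2 + (Vt.a₁ * xb + Vt.a₃) * yb - (xb ^ 3 + Vt.a₂ * xb ^ 2 + Vt.a₄ * xb + Vt.a₆) = 0 := by
        rw [WeierstrassCurve.Affine.equation_iff'] at hyb
        linear_combination hyb
      have h2 := pow_pow_eq_self_of_quadratic p ((f : ℕ) * g) (β := Vt.a₁ * xb + Vt.a₃)
        (γ := xb ^ 3 + Vt.a₂ * xb ^ 2 + Vt.a₄ * xb + Vt.a₆) (y := yb)
        (by rw [hpq]; exact hβ) (by rw [hpq]; exact hγ) he
      rw [hpq, ← pow_mul] at h2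
      rwa [hng, pow_mul', sq]
    -- lift it to an algebraic integral layer point
    obtain ⟨x, y, hxK, hyK, hxalg, -, hx1, hy1, heq, hrx, -⟩ :=
      exists_algebraic_lift_point hw hr hn hζ W ι (hTgpow' xb hxT) hypow hns
    have hP : (V[W]).toAffine.Nonsingular x y := WeierstrassCurve.Affine.equation_iff_nonsingular.mp heq
    have hRg : (.some x y hP : (V[W]).toAffine.Point) ∈ Rg[W] := some_mem_range_map W hP hxK hyK
    obtain ⟨P, hPι⟩ := some_mem_range_emb W ι hP hxalg
    exact ⟨P, by rw [hPι]; exact hRg, x, y, hP, hx1, hy1, hPι, hrx⟩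
  choose! Pt hPt using key
  -- distinct good abscissae give points inequivalent modulo `E₁`
  have sep : ∀ a ∈ Tg \ D.roots.toFinset, ∀ b ∈ Tg \ D.roots.toFinset, a ≠ b →
      ι⁎[W] (Pt a - Pt b) ∉ kernel w (V[W]) := by
    intro a ha b hb hab
    obtain ⟨-, x, y, h, hx1, hy1, hPa, hra⟩ := hPt a ha
    obtain ⟨-, x', y', h', hx1', hy1', hPb, hrb⟩ := hPt b hb
    rw [map_sub, hPa, hPb]
    refine not_sub_mem_kernel_of_residue_ne hr hx1 hy1 hx1' hy1' ?_
    rw [hra, hrb]; exact hab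
  have hinj : Set.InjOn Pt ↑(Tg \ D.roots.toFinset) := by
    intro a ha b hb he
    by_contra hab
    refine sep a (Finset.mem_coe.mp ha) b (Finset.mem_coe.mp hb) hab ?_
    rw [he, sub_self, map_zero]
    exact no_implicit_lambda% (AddSubgroup.zero_mem _)
  refine ⟨(Tg \ D.roots.toFinset).image Pt, ?_, ?_, ?_⟩
  · -- `q^g = #Tg ≤ #good + #roots ≤ #S + 3`
    rw [Finset.card_image_of_injOn hinj, ← hTgcard]
    refine (Finset.card_le_card_sdiff_add_card (s := Tg) (t := D.roots.toFinset)).trans ?_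
    refine Nat.add_le_add_left ((Multiset.toFinset_card_le _).trans ((card_roots' D).trans hDdeg)) _
  · intro P hP
    obtain ⟨a, ha, rfl⟩ := Finset.mem_image.mp hP
    exact (hPt a ha).1
  · intro P hP P' hP' hne
    obtain ⟨a, ha, rfl⟩ := Finset.mem_image.mp hP
    obtain ⟨b, hb, rfl⟩ := Finset.mem_image.mp hP'
    exact sep a ha b hb (fun hab ↦ hne (by rw [hab]))

end IsDedekindDomain.HeightOneSpectrum

end

/-!
## Part B. `qⁿ` algebraic points on each level of `E₁(K_n)`, and the product family

Part B (theorems only): fifth local step of the proof of the named fact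
`Literature.NumberTheory.EllipticCurves.integral_neronScaling_of_isGloballyMinimal` by counting
points over unramified layers (architecture: `NeronIsogenyScalingProofs.lean`). The source-side
LOWER bound: for `W/K` elliptic, `W ⊗ K̄_v` `w`-integral, the layer `K_n = K_v(ζ)` and an
ALGEBRAIC uniformiser `π ∈ K` of `v` (`exists_irreducible_algebraMap`), every level
`E⁽ρʲ⁾(K_n)`, `j ≥ 1`, `ρ = |π|_v`, contains `qⁿ` algebraic points pairwise inequivalent modulo
`E⁽ρʲ⁺¹⁾` (`exists_level_family`: the points of parameter `z = πʲt`, `t ∈ {0} ∪ μ_{qⁿ-1}`, of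
`exists_mem_kernel_mem_range_zCoord_eq`, which are algebraic because `z` is); summing one point
from each level `0 ≤ j < N` (level `0`: any family of algebraic layer points pairwise inequivalent
modulo `E₁`, e.g. that of `exists_levelZero_family`) gives `#S₀ · q^{n(N-1)}` algebraic layer
points pairwise inequivalent modulo `E⁽ρᴺ⁾` (`exists_product_family`; the first level where two
sums differ decides).

## References

* [SilvermanAEC2009] J. H. Silverman, *The Arithmetic of Elliptic Curves*, 2nd ed., GTM 106
  (2009): Prop. IV.3.2(a), Prop. VII.2.2 (the filtration of `E₁` and its graded pieces).
* [SerreLocalFields1979] J.-P. Serre, *Local Fields*, GTM 67 (1979): II §4 Prop. 8.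

## Design

Theorems only (D-0026); setting, notation and hypotheses verbatim those of the previous local
steps; the subgroups of `E(K̄)` are the preimages (`AddSubgroup.comap`) of the layer / kernel /
level subgroups of `X(K̄_v)` under the transport `ι_*`.
-/

noncomputable section

open scoped Classical NNReal Pointwise
open NumberField IsDedekindDomain Polynomial

universe u

/-! ## Generic combinatorics: summing separated families along a chain of subgroups -/

namespace Literature.NumberTheory.EllipticCurves

/-- **Product of separated families.** In an abelian group with subgroups `Hs ≤ Hb`: if the
elements of `S` are pairwise inequivalent modulo `Hb`, the elements of `F` lie in `Hb` and are
pairwise inequivalent modulo `Hs`, then the sums `s + f` are pairwise distinct for distinct pairs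
and pairwise inequivalent modulo `Hs` (if `s ≠ s'` the difference is `≡ s - s' ∉ Hb ⊇ Hs`
modulo `Hb`; if `s = s'` it is `f - f' ∉ Hs`). [folklore] -/
theorem card_image_add_eq_and_pairwise {G : Type*} [AddCommGroup G] [DecidableEq G]
    {Hb Hs : AddSubgroup G} (hle : Hs ≤ Hb) {S F : Finset G}
    (hS : ∀ s ∈ S, ∀ s' ∈ S, s ≠ s' → s - s' ∉ Hb) (hF : ∀ f ∈ F, f ∈ Hb)
    (hFs : ∀ f ∈ F, ∀ f' ∈ F, f ≠ f' → f - f' ∉ Hs) :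
    ((S ×ˢ F).image fun p ↦ p.1 + p.2).card = S.card * F.card ∧
      ∀ t ∈ (S ×ˢ F).image (fun p ↦ p.1 + p.2), ∀ t' ∈ (S ×ˢ F).image (fun p ↦ p.1 + p.2),
        t ≠ t' → t - t' ∉ Hs := by
  -- the key separation statement on pairs
  have key : ∀ p ∈ S ×ˢ F, ∀ p' ∈ S ×ˢ F, p ≠ p' → (p.1 + p.2) - (p'.1 + p'.2) ∉ Hs := by
    rintro ⟨s, f⟩ hp ⟨s', f'⟩ hp' hne hmem
    obtain ⟨hs, hf⟩ := Finset.mem_product.mp hp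
    obtain ⟨hs', hf'⟩ := Finset.mem_product.mp hp'
    have e : s + f - (s' + f') = (s - s') + (f - f') := by abel
    rw [e] at hmem
    by_cases hss : s = s'
    · subst hss
      have hff : f ≠ f' := fun h ↦ hne (by rw [h])
      rw [sub_self, zero_add] at hmem
      exact hFs f hf f' hf' hff hmem
    · have h1 : (s - s') + (f - f') ∈ Hb := hle hmem
      have h2 : s - s' ∈ Hb := by
        have := Hb.sub_mem h1 (Hb.sub_mem (hF f hf) (hF f' hf'))
        rwa [add_sub_cancel_right] at this
      exact hS s hs s' hs' hss h2
  have hinj : Set.InjOn (fun p : G × G ↦ p.1 + p.2) ↑(S ×ˢ F) := by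
    intro p hp p' hp' he
    by_contra hne
    exact key p (Finset.mem_coe.mp hp) p' (Finset.mem_coe.mp hp') hne
      (by simp only at he; rw [he, sub_self]; exact Hs.zero_mem)
  refine ⟨by rw [Finset.card_image_of_injOn hinj, Finset.card_product], ?_⟩
  intro t ht t' ht' hne
  obtain ⟨p, hp, rfl⟩ := Finset.mem_image.mp ht
  obtain ⟨p', hp', rfl⟩ := Finset.mem_image.mp ht'
  exact key p hp p' hp' (fun h ↦ hne (by rw [h]))

end Literature.NumberTheory.EllipticCurves

/-! ## The local setting -/

namespace IsDedekindDomain.HeightOneSpectrum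

open Literature.NumberTheory.EllipticCurves Literature.NumberTheory.GaloisRepresentations Field
  Literature.NumberTheory.EllipticCurves.FormalGroupChart

variable {K : Type u} [Field K] [NumberField K] {v : HeightOneSpectrum (𝓞 K)}
  {w : Valuation (AlgebraicClosure (v.adicCompletion K)) ℝ≥0}
  (hw : ∀ x, (w x : ℝ) = spectralNorm (v.adicCompletion K) (AlgebraicClosure (v.adicCompletion K)) x)
  {n : ℕ} (hn : n ≠ 0) {ζ : AlgebraicClosure (v.adicCompletion K)}
  (hζ : IsPrimitiveRoot ζ (Nat.card (IsLocalRing.ResidueField (v.adicCompletionIntegers K)) ^ n - 1))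
  (W : WeierstrassCurve K)
  (ι : AlgebraicClosure K →ₐ[K] AlgebraicClosure (v.adicCompletion K))

/-- `K_v`. -/
local notation3 "𝕂" => v.adicCompletion K
/-- `K̄_v`. -/
local notation3 "𝕃" => AlgebraicClosure (v.adicCompletion K)
/-- `q = #k_v`. -/
local notation3 "𝔮" => Nat.card (IsLocalRing.ResidueField (v.adicCompletionIntegers K))
/-- `X ⊗ K̄_v` for `X = Y ⊗ K_v`. -/
local notation3 "V[" Y "]" =>
  WeierstrassCurve.baseChange (WeierstrassCurve.baseChange Y (v.adicCompletion K))
    (AlgebraicClosure (v.adicCompletion K))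
/-- The layer points `E(K_n) ≤ X(K̄_v)`. -/
local notation3 "Rg[" Y "]" => (WeierstrassCurve.Affine.Point.map
  (W' := WeierstrassCurve.baseChange Y (v.adicCompletion K))
  (IntermediateField.val (IntermediateField.adjoin (v.adicCompletion K) {ζ}))).range
/-- The transport `ι_* : E(K̄) →+ X(K̄_v)`. -/
local notation3 "ι⁎[" Y "]" => AddMonoidHom.comp
  (WeierstrassCurve.Affine.Point.congrEquiv
    (WeierstrassCurve.baseChange_baseChange_adicCompletion Y v).symm).toAddMonoidHom
  (pointsMapOfEmb Y ι)

/-! ## An algebraic uniformiser -/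

/-- **`K` contains a uniformiser of `𝓞_v`**: some `π ∈ K` is an irreducible element of the
discrete valuation ring `𝓞_v ⊆ K_v` (`valuation_exists_uniformizer`: `v(π) = 1`; an element of
normalised valuation `1` is irreducible). [folklore] -/
theorem exists_irreducible_algebraMap :
    ∃ (π : K) (h : algebraMap K 𝕂 π ∈ v.adicCompletionIntegers K),
      Irreducible (⟨algebraMap K 𝕂 π, h⟩ : v.adicCompletionIntegers K) := by
  obtain ⟨π, hπ⟩ := v.valuation_exists_uniformizer K
  have hvπ : Valued.v (algebraMap K 𝕂 π) = WithZero.exp (-1 : ℤ) := by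
    rw [← hπ]; exact valuedAdicCompletion_eq_valuation' v π
  have hle : Valued.v (algebraMap K 𝕂 π) ≤ 1 := by
    rw [hvπ, ← WithZero.exp_zero, WithZero.exp_le_exp]; norm_num
  have hmem : algebraMap K 𝕂 π ∈ v.adicCompletionIntegers K := hle
  refine ⟨π, hmem, ?_⟩
  have hint : Valued.v.Integers (v.adicCompletionIntegers K) :=
    Valuation.valuationSubring.integers (Valued.v : Valuation 𝕂 (WithZero (Multiplicative ℤ)))
  -- units of `𝓞_v` have valuation `1`; elements of valuation `< 1` have valuation `≤ exp (-1)`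
  have hunit : ∀ x : v.adicCompletionIntegers K, IsUnit x ↔ Valued.v (x : 𝕂) = 1 := fun x ↦
    hint.isUnit_iff_valuation_eq_one
  have hdisc : ∀ x : v.adicCompletionIntegers K, Valued.v (x : 𝕂) < 1 →
      Valued.v (x : 𝕂) ≤ WithZero.exp (-1 : ℤ) := by
    intro x hx
    rcases eq_or_ne (Valued.v (x : 𝕂)) 0 with h0 | h0
    · rw [h0]; exact zero_le
    · rw [← WithZero.exp_log h0] at hx ⊢
      rw [← WithZero.exp_zero, WithZero.exp_lt_exp] at hx
      rw [WithZero.exp_le_exp]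
      omega
  refine ⟨fun h ↦ ?_, fun a b hab ↦ ?_⟩
  · rw [hunit] at h
    change Valued.v (algebraMap K 𝕂 π) = 1 at h
    rw [hvπ, ← WithZero.exp_zero] at h
    exact absurd (WithZero.exp_injective h) (by norm_num)
  · by_contra hab'
    obtain ⟨ha, hb⟩ := not_or.mp hab'
    rw [hunit] at ha hb
    have ha1 : Valued.v (a : 𝕂) < 1 := lt_of_le_of_ne (hint.map_le_one a) ha
    have hb1 : Valued.v (b : 𝕂) < 1 := lt_of_le_of_ne (hint.map_le_one b) hb
    have hprod : Valued.v (algebraMap K 𝕂 π) = Valued.v (a : 𝕂) * Valued.v (b : 𝕂) := by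
      rw [← map_mul]; exact congrArg _ (congrArg Subtype.val hab)
    have hlt : Valued.v (a : 𝕂) * Valued.v (b : 𝕂) ≤ WithZero.exp (-1 : ℤ) * WithZero.exp (-1 : ℤ) :=
      mul_le_mul' (hdisc a ha1) (hdisc b hb1)
    rw [← hprod, hvπ, ← WithZero.exp_add, WithZero.exp_le_exp] at hlt
    norm_num at hlt

/-! ## `qⁿ` algebraic points on each level -/

/-- A point of `E₁ ⊆ X(K̄_v)` (`X = W ⊗ K_v`) with ALGEBRAIC parameter `z(P) ∈ ι(K̄)` is
algebraic: `y` is a root of the cubic `z³y³ + (1 - a₁z - a₂z²)y² + (a₃ + a₄z)y - a₆`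
(`root_of_equation`), nonzero for `z ≠ 0`, and `x = -zy`. [cite: SilvermanAEC2009, IV.1] -/
theorem mem_range_emb_of_zCoord_mem [(V[W]).IsIntegral w.integer]
    {P : (V[W]).toAffine.Point} (hP : P ∈ kernel w (V[W])) (hz : P.zCoord ∈ Set.range ι) :
    P ∈ (ι⁎[W]).range := by
  rcases P with _ | ⟨x, y, h⟩
  · exact ⟨0, by rw [map_zero]; rfl⟩
  have hrange : ∀ z : 𝕃, z ∈ Set.range ι ↔ z ∈ ι.range := fun z ↦ by
    rw [← AlgHom.coe_range]; rfl
  obtain ⟨ha₁, ha₂, ha₃, ha₄, ha₆⟩ := coeff_mem_range_emb (v := v) W ι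
  rw [WeierstrassCurve.Affine.Point.zCoord_some] at hz
  set z : 𝕃 := -x / y with hz_def
  obtain ⟨-, -, hy0⟩ := val_X_mul_val_zCoord_sq hP
  have hx1 : 1 < w x := (some_mem_kernel_iff _).mp hP
  have hx0 : x ≠ 0 := fun h0 ↦ by rw [h0, map_zero] at hx1; exact not_lt_zero hx1
  have hz0 : z ≠ 0 := by rw [hz_def]; exact div_ne_zero (neg_ne_zero.mpr hx0) hy0
  have hroot := root_of_equation (V := V[W]) h.1 hy0
  -- the cubic in `y` with algebraic coefficients
  let H : 𝕃[X] := C (z ^ 3) * X ^ 3 + C (1 - (V[W]).a₁ * z - (V[W]).a₂ * z ^ 2) * X ^ 2 +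
    C ((V[W]).a₃ + (V[W]).a₄ * z) * X + C (-(V[W]).a₆)
  have hHy : H.eval y = 0 := by
    simp only [H, eval_add, eval_mul, eval_C, eval_pow, eval_X]
    rw [← hz_def] at hroot
    linear_combination hroot
  have hH3 : H.coeff 3 = z ^ 3 := by
    simp only [H, coeff_add, coeff_C_mul, coeff_X_pow, coeff_X, coeff_C]
    norm_num
  have hH0 : H ≠ 0 := fun h0 ↦ by
    have := hH3; rw [h0, coeff_zero] at this; exact pow_ne_zero 3 hz0 this.symm
  have hmem : ∀ {a b : 𝕃}, a ∈ Set.range ι → b ∈ Set.range ι →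
      a + b ∈ Set.range ι ∧ a * b ∈ Set.range ι ∧ a - b ∈ Set.range ι := by
    intro a b ha hb
    rw [hrange] at ha hb ⊢; rw [hrange, hrange]
    exact ⟨add_mem ha hb, mul_mem ha hb, sub_mem ha hb⟩
  have hpow : ∀ {a : 𝕃}, a ∈ Set.range ι → ∀ k : ℕ, a ^ k ∈ Set.range ι := by
    intro a ha k; rw [hrange] at ha ⊢; exact pow_mem ha k
  have h1 : (1 : 𝕃) ∈ Set.range ι := ⟨1, map_one ι⟩
  have hHl : H ∈ Polynomial.lifts (ι : AlgebraicClosure K →+* 𝕃) := by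
    obtain ⟨a6, ha6⟩ := ha₆
    refine add_mem (add_mem (add_mem (mul_mem (Polynomial.C'_mem_lifts (hpow hz 3))
      (pow_mem (Polynomial.X_mem_lifts _) 3)) (mul_mem (Polynomial.C'_mem_lifts ?_)
      (pow_mem (Polynomial.X_mem_lifts _) 2))) (mul_mem (Polynomial.C'_mem_lifts ?_)
      (Polynomial.X_mem_lifts _))) (Polynomial.C'_mem_lifts ⟨-a6, by rw [map_neg, RingHom.coe_coe, ha6]⟩)
    · exact (hmem (hmem h1 (hmem ha₁ hz).2.1).2.2 (hmem ha₂ (hpow hz 2)).2.1).2.2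
    · exact (hmem ha₃ (hmem ha₄ hz).2.1).1
  have hyalg : y ∈ Set.range ι :=
    mem_range_of_eval_eq_zero_of_mem_lifts (ι : AlgebraicClosure K →+* 𝕃) hH0 hHl hHy
  have hxalg : x ∈ Set.range ι := by
    have e : x = -(z * y) := by rw [hz_def]; field_simp
    rw [e, hrange]; exact neg_mem (by rw [← hrange]; exact (hmem hz hyalg).2.1)
  exact some_mem_range_emb W ι h hxalg

include hw hn hζ in
/-- **`qⁿ` algebraic points on the level `E⁽ρʲ⁾(K_n)`, pairwise inequivalent modulo
`E⁽ρʲ⁺¹⁾`** (`j ≥ 1`, `ρ = |π|_v` for an algebraic uniformiser `π ∈ K`): the points of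
parameter `z = πʲt`, `t ∈ {0} ∪ {ζⁱ : i < qⁿ - 1}` (`exists_mem_kernel_mem_range_zCoord_eq`),
algebraic by `mem_range_emb_of_zCoord_mem`; for `t ≠ t'`, `|z - z'| = ρʲ|t - t'| = ρʲ > ρʲ⁺¹`
(`one_le_spectralValuation_sub_of_ne`). [cite: SilvermanAEC2009, Prop. IV.3.2(a) with Prop. VII.2.2] -/
theorem exists_level_family [(V[W]).IsIntegral w.integer] [W.IsElliptic] {π : K}
    (hπ0 : 0 < w (algebraMap K 𝕃 π)) (hπ1 : w (algebraMap K 𝕃 π) < 1) {j : ℕ} (hj : 1 ≤ j) :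
    ∃ S : Finset W.geomPoints, S.card = 𝔮 ^ n ∧
      (∀ P ∈ S, ι⁎[W] P ∈ Rg[W] ∧ ι⁎[W] P ∈ level w (V[W]) (w (algebraMap K 𝕃 π) ^ j)) ∧
      ∀ P ∈ S, ∀ P' ∈ S, P ≠ P' →
        ι⁎[W] (P - P') ∉ level w (V[W]) (w (algebraMap K 𝕃 π) ^ (j + 1)) := by
  have hm0 := residueCard_pow_sub_one_ne_zero (v := v) hn
  have hζ1 : w ζ ≤ 1 := spectralValuation_le_one_of_isPrimitiveRoot hn hζ
  set ρ : ℝ≥0 := w (algebraMap K 𝕃 π) with hρ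
  have hπK : algebraMap K 𝕃 π ∈ IntermediateField.adjoin 𝕂 {ζ} := by
    rw [IsScalarTower.algebraMap_apply K 𝕂 𝕃]; exact algebraMap_mem _ _
  have hπalg : algebraMap K 𝕃 π ∈ Set.range ι := ⟨algebraMap K _ π, ι.commutes π⟩
  have hζalg : ζ ∈ Set.range ι := mem_range_emb_of_pow_eq_one ι hm0 hζ.pow_eq_one
  -- the Teichmüller set of the layer
  let T : Finset 𝕃 := insert (0 : 𝕃) ((Finset.range (𝔮 ^ n - 1)).image (fun i : ℕ ↦ ζ ^ i))
  have hTcard : T.card = 𝔮 ^ n := by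
    rw [card_insert_zero_image_pow hζ hm0]; exact Nat.sub_add_cancel (Nat.one_le_pow n _ Nat.card_pos)
  have hT : ∀ t ∈ T, t ∈ IntermediateField.adjoin 𝕂 {ζ} ∧ t ∈ Set.range ι ∧ w t ≤ 1 := by
    intro t ht
    rcases Finset.mem_insert.mp ht with rfl | ht
    · exact ⟨zero_mem _, ⟨0, map_zero _⟩, by rw [map_zero]; exact zero_le_one⟩
    · obtain ⟨i, -, rfl⟩ := Finset.mem_image.mp ht
      obtain ⟨z₀, hz₀⟩ := hζalg
      exact ⟨pow_mem (IntermediateField.mem_adjoin_simple_self _ ζ) i, ⟨z₀ ^ i, by rw [map_pow, hz₀]⟩,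
        by rw [map_pow]; exact pow_le_one₀ zero_le hζ1⟩
  -- for each `t`, the algebraic layer point of parameter `πʲ t`
  have key : ∀ t ∈ T, ∃ P : W.geomPoints, ι⁎[W] P ∈ Rg[W] ∧ ι⁎[W] P ∈ kernel w (V[W]) ∧
      (ι⁎[W] P).zCoord = algebraMap K 𝕃 π ^ j * t := by
    intro t ht
    obtain ⟨htK, htalg, ht1⟩ := hT t ht
    have hzK : algebraMap K 𝕃 π ^ j * t ∈ IntermediateField.adjoin 𝕂 {ζ} := mul_mem (pow_mem hπK j) htK
    have hz1 : w (algebraMap K 𝕃 π ^ j * t) < 1 := by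
      rw [map_mul, map_pow]
      calc ρ ^ j * w t ≤ ρ ^ j * 1 := mul_le_mul_of_nonneg_left ht1 zero_le
        _ = ρ ^ j := mul_one _
        _ < 1 := pow_lt_one₀ zero_le hπ1 (by omega)
    obtain ⟨P, hP1, hPRg, hPz⟩ := exists_mem_kernel_mem_range_zCoord_eq hw (W.baseChange 𝕂) hm0
      hζ.pow_eq_one ⟨_, hzK⟩ hz1
    have hzalg : P.zCoord ∈ Set.range ι := by
      rw [hPz]
      obtain ⟨a, ha⟩ := hπalg; obtain ⟨b, hb⟩ := htalg
      exact ⟨a ^ j * b, by rw [map_mul, map_pow, ha, hb]⟩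
    obtain ⟨P₀, hP₀⟩ := mem_range_emb_of_zCoord_mem W ι hP1 hzalg
    exact ⟨P₀, by rw [hP₀]; exact hPRg, by rw [hP₀]; exact hP1, by rw [hP₀]; exact hPz⟩
  choose! Pt hPt using key
  have hlev : ∀ t ∈ T, ι⁎[W] (Pt t) ∈ level w (V[W]) (ρ ^ j) := fun t ht ↦ by
    obtain ⟨-, h1, hz⟩ := hPt t ht
    refine mem_level_iff.mpr ⟨h1, ?_⟩
    rw [hz, map_mul, map_pow]
    calc ρ ^ j * w t ≤ ρ ^ j * 1 := mul_le_mul_of_nonneg_left (hT t ht).2.2 zero_le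
      _ = ρ ^ j := mul_one _
  have hsep : ∀ t ∈ T, ∀ t' ∈ T, t ≠ t' → ι⁎[W] (Pt t - Pt t') ∉ level w (V[W]) (ρ ^ (j + 1)) := by
    intro t ht t' ht' hne hmem
    obtain ⟨-, h1, hz⟩ := hPt t ht
    obtain ⟨-, h1', hz'⟩ := hPt t' ht'
    rw [map_sub, sub_mem_level_iff h1 h1', hz, hz', ← mul_sub, map_mul, map_pow] at hmem
    have h1le := one_le_spectralValuation_sub_of_ne hw hn hζ ht ht' hne
    have : ρ ^ j * 1 ≤ ρ ^ (j + 1) := (mul_le_mul_of_nonneg_left h1le zero_le).trans hmem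
    rw [mul_one, pow_succ] at this
    have hρj : 0 < ρ ^ j := pow_pos hπ0 j
    exact absurd (le_of_mul_le_mul_left (by rwa [mul_one]) hρj) (not_le.mpr hπ1)
  have hinj : Set.InjOn Pt ↑T := by
    intro t ht t' ht' he
    by_contra hne
    refine hsep t (Finset.mem_coe.mp ht) t' (Finset.mem_coe.mp ht') hne ?_
    rw [he, sub_self, map_zero]; exact AddSubgroup.zero_mem _
  refine ⟨T.image Pt, by rw [Finset.card_image_of_injOn hinj, hTcard], ?_, ?_⟩
  · intro P hP
    obtain ⟨t, ht, rfl⟩ := Finset.mem_image.mp hP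
    exact ⟨(hPt t ht).1, hlev t ht⟩
  · intro P hP P' hP' hne
    obtain ⟨t, ht, rfl⟩ := Finset.mem_image.mp hP
    obtain ⟨t', ht', rfl⟩ := Finset.mem_image.mp hP'
    exact hsep t ht t' ht' (fun h ↦ hne (by rw [h]))

/-! ## The product family -/

include hw hn hζ in
/-- **The product family.** Given a finite set `S₀` of algebraic layer points of `W` pairwise
inequivalent modulo `E₁`, and `N ≥ 1`: there are `#S₀ · q^{n(N-1)}` algebraic layer points
pairwise inequivalent modulo `E⁽ρᴺ⁾` (`ρ = |π|_v`, `π ∈ K` an algebraic uniformiser) — the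
sums `s₀ + s₁ + ⋯ + s_{N-1}` with `s_j` from the level-`j` family (`exists_level_family`,
`card_image_add_eq_and_pairwise`). [cite: SilvermanAEC2009, Prop. IV.3.2(a) with Prop. VII.2.2] -/
theorem exists_product_family [(V[W]).IsIntegral w.integer] [W.IsElliptic] {π : K}
    (hπ0 : 0 < w (algebraMap K 𝕃 π)) (hπ1 : w (algebraMap K 𝕃 π) < 1)
    {S₀ : Finset W.geomPoints} (hS₀ : ∀ P ∈ S₀, ι⁎[W] P ∈ Rg[W])
    (hS₀sep : ∀ P ∈ S₀, ∀ P' ∈ S₀, P ≠ P' → ι⁎[W] (P - P') ∉ kernel w (V[W]))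
    {N : ℕ} (hN : 1 ≤ N) :
    ∃ S : Finset W.geomPoints, S.card = S₀.card * (𝔮 ^ n) ^ (N - 1) ∧
      (∀ P ∈ S, ι⁎[W] P ∈ Rg[W]) ∧
      ∀ P ∈ S, ∀ P' ∈ S, P ≠ P' → ι⁎[W] (P - P') ∉ level w (V[W]) (w (algebraMap K 𝕃 π) ^ N) := by
  set ρ : ℝ≥0 := w (algebraMap K 𝕃 π) with hρ
  -- pull back the subgroups along `ι_*`
  let A : AddSubgroup W.geomPoints := (Rg[W]).comap (ι⁎[W])
  let Lv : ℝ≥0 → AddSubgroup W.geomPoints := fun t ↦ (level w (V[W]) t ⊓ Rg[W]).comap (ι⁎[W])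
  have hLv_anti : ∀ {t t' : ℝ≥0}, t ≤ t' → Lv t ≤ Lv t' := fun h ↦
    AddSubgroup.comap_mono (inf_le_inf_right _ (level_mono h))
  have hρle : ∀ {a b : ℕ}, a ≤ b → ρ ^ b ≤ ρ ^ a := fun h ↦ pow_le_pow_right_of_le_one' hπ1.le h
  -- descending induction: families `F_d ⊆ Lv (ρ^(N-d))` of size `q^{nd}` separated modulo `Lv (ρ^N)`
  have step : ∀ d, d ≤ N - 1 → ∃ F : Finset W.geomPoints, F.card = (𝔮 ^ n) ^ d ∧
      (∀ f ∈ F, f ∈ Lv (ρ ^ (N - d))) ∧ ∀ f ∈ F, ∀ f' ∈ F, f ≠ f' → f - f' ∉ Lv (ρ ^ N) := by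
    intro d
    induction d with
    | zero =>
      intro _
      refine ⟨{0}, by rw [Finset.card_singleton, pow_zero], fun f hf ↦ ?_, fun f hf f' hf' hne ↦ ?_⟩
      · rw [Finset.mem_singleton] at hf; rw [hf]; exact AddSubgroup.zero_mem _
      · rw [Finset.mem_singleton] at hf hf'; exact (hne (hf.trans hf'.symm)).elim
    | succ d ih =>
      intro hd
      obtain ⟨F, hFcard, hFmem, hFsep⟩ := ih (by omega)
      have hj : 1 ≤ N - (d + 1) := by omega
      obtain ⟨Sj, hSjcard, hSjmem, hSjsep⟩ := exists_level_family hw hn hζ W ι hπ0 hπ1 hj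
      have hjN : N - (d + 1) + 1 = N - d := by omega
      -- combine with `Hb = Lv (ρ^(N-d))`, `Hs = Lv (ρ^N)`
      have hle : Lv (ρ ^ N) ≤ Lv (ρ ^ (N - d)) := hLv_anti (hρle (Nat.sub_le N d))
      have hS' : ∀ s ∈ Sj, ∀ s' ∈ Sj, s ≠ s' → s - s' ∉ Lv (ρ ^ (N - d)) := by
        intro s hs s' hs' hne hmem
        refine hSjsep s hs s' hs' hne ?_
        rw [hjN]; exact (AddSubgroup.mem_inf.mp (AddSubgroup.mem_comap.mp hmem)).1
      obtain ⟨hcard, hsep⟩ := card_image_add_eq_and_pairwise hle hS' hFmem hFsep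
      refine ⟨(Sj ×ˢ F).image fun p ↦ p.1 + p.2, by rw [hcard, hSjcard, hFcard, pow_succ'], ?_, hsep⟩
      intro f hf
      obtain ⟨⟨s, f₀⟩, hp, rfl⟩ := Finset.mem_image.mp hf
      obtain ⟨hs, hf₀⟩ := Finset.mem_product.mp hp
      refine add_mem ?_ (hLv_anti (hρle (by omega)) (hFmem f₀ hf₀))
      obtain ⟨hRg, hlev⟩ := hSjmem s hs
      exact AddSubgroup.mem_comap.mpr (AddSubgroup.mem_inf.mpr ⟨hlev, hRg⟩)
  obtain ⟨F, hFcard, hFmem, hFsep⟩ := step (N - 1) le_rfl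
  -- finally add the level-zero family (`Hb = E₁ ∩` layer, pulled back)
  let Kr : AddSubgroup W.geomPoints := (kernel w (V[W]) ⊓ Rg[W]).comap (ι⁎[W])
  have hle : Lv (ρ ^ N) ≤ Kr := AddSubgroup.comap_mono (inf_le_inf_right _ (level_le_kernel _))
  have hS' : ∀ s ∈ S₀, ∀ s' ∈ S₀, s ≠ s' → s - s' ∉ Kr := fun s hs s' hs' hne hmem ↦
    hS₀sep s hs s' hs' hne (AddSubgroup.mem_inf.mp (AddSubgroup.mem_comap.mp hmem)).1
  have hF' : ∀ f ∈ F, f ∈ Kr := fun f hf ↦ by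
    have h := hFmem f hf
    rw [Nat.sub_sub_self hN] at h
    obtain ⟨hlev, hRg⟩ := AddSubgroup.mem_inf.mp (AddSubgroup.mem_comap.mp h)
    exact AddSubgroup.mem_comap.mpr (AddSubgroup.mem_inf.mpr ⟨level_le_kernel _ hlev, hRg⟩)
  obtain ⟨hcard, hsep⟩ := card_image_add_eq_and_pairwise hle hS' hF' hFsep
  refine ⟨(S₀ ×ˢ F).image fun p ↦ p.1 + p.2, by rw [hcard, hFcard], ?_, ?_⟩
  · intro P hP
    obtain ⟨⟨s, f⟩, hp, rfl⟩ := Finset.mem_image.mp hP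
    obtain ⟨hs, hf⟩ := Finset.mem_product.mp hp
    rw [map_add]
    exact add_mem (hS₀ s hs) (AddSubgroup.mem_inf.mp (AddSubgroup.mem_comap.mp (hF' f hf))).2
  · intro P hP P' hP' hne hmem
    refine hsep P hP P' hP' hne (AddSubgroup.mem_comap.mpr (AddSubgroup.mem_inf.mpr ⟨hmem, ?_⟩))
    -- layer membership of the difference
    have hA : ∀ Q ∈ (S₀ ×ˢ F).image (fun p ↦ p.1 + p.2), ι⁎[W] Q ∈ Rg[W] := by
      intro Q hQ
      obtain ⟨⟨s, f⟩, hp, rfl⟩ := Finset.mem_image.mp hQ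
      obtain ⟨hs, hf⟩ := Finset.mem_product.mp hp
      rw [map_add]
      exact add_mem (hS₀ s hs) (AddSubgroup.mem_inf.mp (AddSubgroup.mem_comap.mp (hF' f hf))).2
    rw [map_sub]; exact sub_mem (hA P hP) (hA P' hP')

end IsDedekindDomain.HeightOneSpectrum

end

/-!
## Part C. Integrality of the Néron scaling: discharge of `integral_neronScaling_of_isGloballyMinimal`

Part C (theorems only): the ASSEMBLY of the proof of the named fact
`Literature.NumberTheory.EllipticCurves.integral_neronScaling_of_isGloballyMinimal`
(`NeronIsogenyScaling.lean`, Silverman *ATAEC* IV.5–IV.6 with Cor. IV.9.1: a `ℚ`-isogeny between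
globally minimal models scales the Néron lattices by an INTEGER). The archimedean half
(`NeronIsogenyScalingProofs`: from `qΛ₀ ⊆ Λ'` an isogeny `φ` defined over `ℚ` with
`x ∘ φ = A(x)/B(x)`, `lc A = q⁻²`, i.e. multiplier `q`) reduced the fact to the integrality of
the multiplier of such an isogeny; the non-archimedean half is proved here by the elementary
COUNTING ARGUMENT over unramified layers replacing the Néron mapping property (which the tree cannot
yet state for Weierstrass models):

* `valuation_multiplier_le_one` — for `W, W'` elliptic over a number field `K`, `W ⊗ K_v`
  integral and `W' ⊗ K_v` MINIMAL at `v`, an isogeny `φ : W → W'` with `x ∘ φ = A/B`,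
  `B` monic, `deg A = deg B + 1`, `lc A = c⁻²`: **`v(c) ≥ 0`**. If `|c|_v = ρ⁻ᵐ > 1`: over
  the layer `K_n`, `n = 2g`, the source has `(q^g - 3)·q^{n(N-1)}` algebraic layer points
  pairwise inequivalent modulo `E⁽ρᴺ⁾` (`exists_levelZero_family`, `exists_product_family`),
  while `φ` (level shift `m`, deep preimages: `card_le_degree_mul_relIndex`) and the target bound
  `[E'(K_n) : E'⁽ρ^{N-m}⁾(K_n)] ≤ C(2qⁿ + 1)q^{n(N-m-1)}` (`exists_relIndex_level_inf_range_le`,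
  Kodaira–Néron over `K_v^{nr}`) allow at most `deg φ · C(2qⁿ + 1)q^{n(N-m-1)}` of them; for
  `m ≥ 1` this gives `q^g ≤ 3·deg φ·C + 3` for all `g`, absurd;
* `integral_neronScaling_of_isGloballyMinimal_holds` — the named fact, for `K = ℚ`: `|q|_p ≤ 1`
  for all `p` and `𝓞_ℚ = ℤ`.

## References

* [SilvermanATAEC1994] J. H. Silverman, *Advanced Topics in the Arithmetic of Elliptic Curves*,
  GTM 151 (1994): IV.5.1, IV.6.1, Cor. IV.9.1, Cor. IV.9.2(d).
* [SilvermanAEC2009] J. H. Silverman, *The Arithmetic of Elliptic Curves*, 2nd ed. (2009):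
  III.4, IV.3, VII.2, VII.6.
* [AgasheRibetStein2006] A. Agashe, K. Ribet, W. A. Stein, *The Manin constant* (2006), §§1–2.

## Design

Theorems only (D-0026). All local inputs (`w`, `𝔐`, `F`, `r`, an algebraic uniformiser, a
primitive root of unity, an embedding `K̄ → K̄_v`) are produced from the tree's existence theorems
inside the proof.
-/

noncomputable section

open scoped Classical NNReal Pointwise
open NumberField IsDedekindDomain Polynomial

universe u

namespace IsDedekindDomain.HeightOneSpectrum

open Literature.NumberTheory.EllipticCurves Literature.NumberTheory.GaloisRepresentations Field
  Literature.NumberTheory.EllipticCurves.FormalGroupChart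

variable {K : Type u} [Field K] [NumberField K]

/-- **The multiplier of an isogeny into a minimal model is `v`-integral.** Let `W, W'` be
elliptic curves over a number field `K`, `v` a finite place with `W ⊗ K_v` integral and
`W' ⊗ K_v` minimal, and `φ : W → W'` an isogeny whose `x`-coordinate is `A(x)/B(x)` off a finite
set, `B` monic, `deg A = deg B + 1`, `lc A = c⁻²`. Then `v(c) ≥ 0`. (For the isogeny `z ↦ cz`
between Néron lattices this is the `v`-part of "`φ^*ω'` is an integral multiple of `ω`",
Silverman *ATAEC* IV.6.1 with IV.5.1 and Cor. IV.9.1; proved here by counting points over the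
unramified layers `K_v(ζ_{q^{2g}-1})`, see the module docstring.)
[cite: SilvermanATAEC1994, IV.5.1 with IV.6.1 and Cor. IV.9.1] -/
theorem valuation_multiplier_le_one (v : HeightOneSpectrum (𝓞 K)) (W W' : WeierstrassCurve K)
    [W.IsElliptic] [W'.IsElliptic]
    [(W.baseChange (v.adicCompletion K)).IsIntegral (v.adicCompletionIntegers K)]
    [(W'.baseChange (v.adicCompletion K)).IsMinimal (v.adicCompletionIntegers K)]
    (φ : WeierstrassCurve.Isogeny W W') {A B : K[X]} {Bad : Set W.geomPoints} {c : K} (hc : c ≠ 0)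
    (hBad : Bad.Finite) (hBm : B.Monic) (hdeg : A.natDegree = B.natDegree + 1)
    (hlc : A.leadingCoeff = c⁻¹ ^ 2)
    (hφ : ∀ (x y : AlgebraicClosure K)
      (h : (W.baseChange (AlgebraicClosure K)).toAffine.Nonsingular x y),
      (.some x y h : W.geomPoints) ∉ Bad → aeval x B ≠ 0 ∧ ∃ (y₂ : AlgebraicClosure K)
        (h₂ : (W'.baseChange (AlgebraicClosure K)).toAffine.Nonsingular (aeval x A / aeval x B) y₂),
        φ (.some x y h) = .some (aeval x A / aeval x B) y₂ h₂) :
    v.valuation K c ≤ 1 := by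
  -- notation
  let E := v.adicCompletion K
  let L := AlgebraicClosure (v.adicCompletion K)
  let q : ℕ := Nat.card (IsLocalRing.ResidueField (v.adicCompletionIntegers K))
  by_contra hgt
  rw [not_le] at hgt
  -- local data: `w`, `𝔐`, `F`, `r`, an algebraic uniformiser
  obtain ⟨w, hw⟩ := exists_spectralValuation v
  obtain ⟨𝔐, h𝔐⟩ := v.localPrimesAbove_nonempty
  obtain ⟨F, hF⟩ := exists_isArithFrobAt_localAbsIntegers (v := v) h𝔐
  obtain ⟨r, hr, -, hrF'⟩ := exists_residueMap (v := v) hw h𝔐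
  have hrF : ∀ (z : w.integer) (h : w (F • (z : L)) ≤ 1), r ⟨F • (z : L), h⟩ = r z ^ q :=
    fun z h ↦ hrF' hF z h
  obtain ⟨π, hπmem, hϖ⟩ := exists_irreducible_algebraMap (K := K) (v := v)
  set ϖ : v.adicCompletionIntegers K := ⟨algebraMap K E π, hπmem⟩ with hϖdef
  have hρπ : w (algebraMap E L (ϖ : E)) = w (algebraMap K L π) := by
    rw [IsScalarTower.algebraMap_apply K E L]
  obtain ⟨hρ0, hρ1⟩ := spectralValuation_uniformizer_pos_lt_one hw hϖ
  rw [hρπ] at hρ0 hρ1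
  set ρ : ℝ≥0 := w (algebraMap K L π) with hρdef
  -- valuations of elements of `K`
  have hle1 : ∀ a : K, w (algebraMap K L a) ≤ 1 ↔ v.valuation K a ≤ 1 := fun a ↦ by
    rw [IsScalarTower.algebraMap_apply K E L, spectralValuation_algebraMap_le_one_iff hw,
      mem_adicCompletionIntegers]
    change Valued.v ((a : E)) ≤ 1 ↔ _
    rw [valuedAdicCompletion_eq_valuation']
  have hc1 : 1 < w (algebraMap K L c) := by
    rw [← not_le, hle1]; exact not_le.mpr hgt
  have hcpos : 0 < w (algebraMap K L c) := zero_lt_one.trans hc1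
  -- `|c|⁻¹ = ρ^m`, `m ≥ 1`
  obtain ⟨m, hm1, hcm⟩ : ∃ m : ℕ, 1 ≤ m ∧ (w (algebraMap K L c))⁻¹ = ρ ^ m := by
    have h0 : 0 < w (algebraMap E L (algebraMap K E c⁻¹)) := by
      rw [← IsScalarTower.algebraMap_apply, map_inv₀, map_inv₀]; exact inv_pos.mpr hcpos
    have h1 : w (algebraMap E L (algebraMap K E c⁻¹)) < 1 := by
      rw [← IsScalarTower.algebraMap_apply, map_inv₀, map_inv₀]; exact inv_lt_one_of_one_lt₀ hc1
    obtain ⟨m, hm1, hm⟩ := exists_spectralValuation_algebraMap_eq_pow hw hϖ h0 h1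
    refine ⟨m, hm1, ?_⟩
    rw [← IsScalarTower.algebraMap_apply, map_inv₀, map_inv₀, hρπ] at hm
    exact hm
  -- integrality of the two curves over `𝒪_w`
  haveI hVW : ((W.baseChange E).baseChange L).IsIntegral w.integer := by
    obtain ⟨M, hM⟩ := (inferInstance : (W.baseChange E).IsIntegral (v.adicCompletionIntegers K)).integral
    rw [hM]; exact WeierstrassCurve.isIntegral_spectralValuation_baseChange hw M
  haveI hVW' : ((W'.baseChange E).baseChange L).IsIntegral w.integer := by
    obtain ⟨M, hM⟩ := (inferInstance : (W'.baseChange E).IsIntegral (v.adicCompletionIntegers K)).integral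
    rw [hM]; exact WeierstrassCurve.isIntegral_spectralValuation_baseChange hw M
  -- the embedding `K̄ → K̄_v`
  let ι : AlgebraicClosure K →ₐ[K] L := closureEmb (K := K) E
  -- the target-side constant
  obtain ⟨C, hC⟩ := exists_relIndex_level_inf_range_le hw h𝔐 hF hr hrF hϖ (W'.baseChange E)
  -- choice of `g`: `q^g > 3 deg φ C + 3`
  have hq1 : 1 < q := by
    haveI : Finite (IsLocalRing.ResidueField (v.adicCompletionIntegers K)) :=
      finite_residueField_adicCompletionIntegers K v
    exact Finite.one_lt_card
  set d : ℕ := φ.degree with hd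
  obtain ⟨g, hg0, hg⟩ : ∃ g : ℕ, g ≠ 0 ∧ 3 * (d * C) + 3 < q ^ g :=
    ⟨3 * (d * C) + 4, by omega, lt_of_lt_of_le (by omega) (Nat.lt_pow_self hq1).le⟩
  have hn : 2 * g ≠ 0 := by omega
  obtain ⟨ζ, hζ⟩ := exists_isPrimitiveRoot_residueCard_pow_sub_one (v := v) hn
  -- the level-zero family over the layer `K_{2g}`
  obtain ⟨S₀, hS₀card, hS₀Rg, hS₀sep⟩ :=
    exists_levelZero_family hw hr hrF hn hζ W ι hg0 rfl
  -- the counting threshold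
  obtain ⟨t₁, ht₁, hcount⟩ := card_le_degree_mul_relIndex hw hn hζ W W' ι φ hc hBad hBm hdeg hlc hφ
  obtain ⟨N₀, hN₀⟩ := exists_pow_lt_of_lt_one ht₁ hρ1
  -- the product family at depth `N = N₀ + m + 1`
  obtain ⟨S, hScard, hSRg, hSsep⟩ := exists_product_family hw hn hζ W ι hρ0 hρ1 hS₀Rg hS₀sep
    (N := N₀ + m + 1) (by omega)
  -- the target-side bound at level `N - m = N₀ + 1`
  obtain ⟨hB, hBfin⟩ := hC hn hζ (N := N₀ + 1) (by omega)
  rw [hρπ] at hB hBfin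
  -- apply the counting inequality with `t = ρ^(N₀ + 1)`
  have ht : ρ ^ (N₀ + 1) < t₁ := (pow_le_pow_right_of_le_one' hρ1.le (Nat.le_succ N₀)).trans_lt hN₀
  have htc : ρ ^ (N₀ + 1) / w (algebraMap K L c) = ρ ^ (N₀ + m + 1) := by
    rw [div_eq_mul_inv, hcm, ← pow_add]; ring_nf
  have key := hcount ht hBfin S hSRg (fun P hP P' hP' hne ↦ by rw [htc]; exact hSsep P hP P' hP' hne)
  -- arithmetic
  have hq0 : 0 < q := by omega
  have hQ : 0 < q ^ (2 * g * (N₀ + m)) := Nat.pow_pos hq0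
  have h1 : S₀.card * q ^ (2 * g * (N₀ + m)) ≤ 3 * (d * C) * q ^ (2 * g * (N₀ + m)) := by
    have e1 : S.card = S₀.card * q ^ (2 * g * (N₀ + m)) := by
      rw [hScard, ← pow_mul, Nat.add_sub_cancel]
    have e2 : (2 * q ^ (2 * g) + 1) * q ^ (2 * g * (N₀ + 1 - 1)) ≤ 3 * q ^ (2 * g * (N₀ + m)) := by
      rw [Nat.add_sub_cancel]
      have hq2g : 1 ≤ q ^ (2 * g) := Nat.one_le_pow _ _ hq0
      calc (2 * q ^ (2 * g) + 1) * q ^ (2 * g * N₀) ≤ (3 * q ^ (2 * g)) * q ^ (2 * g * N₀) := by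
            apply Nat.mul_le_mul_right; omega
        _ = 3 * q ^ (2 * g * (N₀ + 1)) := by rw [mul_add, mul_one, pow_add]; ring
        _ ≤ 3 * q ^ (2 * g * (N₀ + m)) := by
            apply Nat.mul_le_mul_left
            exact Nat.pow_le_pow_right hq0 (Nat.mul_le_mul_left _ (by omega))
    calc S₀.card * q ^ (2 * g * (N₀ + m)) = S.card := e1.symm
      _ ≤ d * ((level w ((W'.baseChange E).baseChange L) (ρ ^ (N₀ + 1)) ⊓ _).relIndex _) := key
      _ ≤ d * (C * ((2 * q ^ (2 * g) + 1) * q ^ (2 * g * (N₀ + 1 - 1)))) := Nat.mul_le_mul_left _ hB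
      _ ≤ d * (C * (3 * q ^ (2 * g * (N₀ + m)))) := Nat.mul_le_mul_left _ (Nat.mul_le_mul_left _ e2)
      _ = 3 * (d * C) * q ^ (2 * g * (N₀ + m)) := by ring
  have h2 : S₀.card ≤ 3 * (d * C) := Nat.le_of_mul_le_mul_right h1 hQ
  change q ^ g ≤ S₀.card + 3 at hS₀card
  generalize d * C = dC at hg h2
  generalize q ^ g = Q at hS₀card hg
  omega

end IsDedekindDomain.HeightOneSpectrum

namespace Literature.NumberTheory.EllipticCurves

open _root_.WeierstrassCurve IsDedekindDomain

/-- **Discharge of the named fact `integral_neronScaling_of_isGloballyMinimal`** (Silverman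
*ATAEC* IV.5.1 with IV.6.1 and Cor. IV.9.1; Agashe–Ribet–Stein 2006 §§1–2): for globally minimal
elliptic curves `W₀, W'` over `ℚ` with Néron-type period pairs and `qΛ₀ ⊆ Λ'`, `q ∈ ℤ`. By
`integral_neronScaling_of_isGloballyMinimal_of_integral_multiplier` it suffices that the
multiplier `r` of the resulting `ℚ`-isogeny is an integer; `|r|_p ≤ 1` at every prime by
`valuation_multiplier_le_one` (the target `W' ⊗ ℚ_p` is minimal), and an everywhere-integral
rational number is an integer. [cite: SilvermanATAEC1994, IV.5.1 with IV.6.1 and Cor. IV.9.1]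
[cite: AgasheRibetStein2006, §§1–2] -/
theorem integral_neronScaling_of_isGloballyMinimal_holds : integral_neronScaling_of_isGloballyMinimal := by
  refine integral_neronScaling_of_isGloballyMinimal_of_integral_multiplier ?_
  intro W₀ W' _ _ _ _ φ A B Bad r hr hBad hBm hdeg hlc hφ
  have hv : ∀ v : HeightOneSpectrum (𝓞 ℚ), v.valuation ℚ r ≤ 1 := fun v ↦ by
    haveI := IsGloballyMinimal.isMinimal (W := W') v
    haveI := IsGloballyMinimal.isMinimal (W := W₀) v
    exact HeightOneSpectrum.valuation_multiplier_le_one v W₀ W' φ hr hBad hBm hdeg hlc hφ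
  obtain ⟨y, hy⟩ := HeightOneSpectrum.mem_integers_of_valuation_le_one (R := 𝓞 ℚ) ℚ r hv
  obtain ⟨k, hk⟩ := (IsIntegrallyClosed.isIntegral_iff (R := ℤ) (K := ℚ)).mp
    (hy ▸ RingOfIntegers.isIntegral_coe y)
  exact ⟨k, by rw [← hk, eq_intCast]⟩

/-! ## Corollaries of the discharge: the Néron scaling of a rational isogeny divides its degree -/

/-- **The Néron scaling of a rational isogeny divides its "lattice degree".** Let `W, W'/ℚ` be
globally minimal elliptic curves with Néron period pairs `L, L'`, `μ ∈ ℚ` with `μ Λ ⊆ Λ'` (so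
`z ↦ μ z` is a `ℚ`-isogeny `W → W'` pulling the Néron differential of `W'` back to `μ` times that of
`W`), and `n ≠ 0` an integer with `n Λ' ⊆ μ Λ` (e.g. `n = [Λ' : μΛ] = deg`). Then `μ ∈ ℤ` and
`μ ∣ n`: by `integral_neronScaling_of_isGloballyMinimal` (discharged above) applied to `μ` and, for
the "dual" inclusion `(n/μ) Λ' ⊆ Λ`, to `n/μ`. In particular for a `p`-isogeny (`n = p` prime) the
scaling is `±1` or `±p` — the dichotomy "`φ^*ω'/ω` = unit or `p`·unit" of Dokchitser–Dokchitser 2015,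
Table 1, holds over `ℚ` between globally minimal models with no hypothesis on the reduction; the
printed theorems (op. cit. Props. 16–18; Gealy–Klagsbrun 2017) decide WHICH. This is the global
(`K = ℚ`, Néron = globally minimal differentials) form of op. cit. Lemma 10 (1) with the proof of
Lemma 11 (arXiv numbering; TAMS §4): "`φ^*ω′ = aω`, `(φᵗ)^*ω = a′ω′` with `a, a′ ∈ 𝒪_K` … Because
`φᵗφ = [p]`, we have `aa′ = p`".
[cite: DokchitserDokchitser2015LocalInvariants, §4 Lemma 10 (1) and proof of Lemma 11 (arXiv:1208.5519 numbering; store paper:arxiv-1208.5519 p0007 L11–19, L36–45): a, a′ integral, aa′ = p]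
[cite: SilvermanATAEC1994, IV.5.1 with IV.6.1 and Cor. IV.9.1 (Néron mapping property: the scaling is integral)] -/
theorem exists_int_eq_and_dvd_of_neronScaling
    (W W' : WeierstrassCurve ℚ) [W.IsElliptic] [W'.IsElliptic] [W.IsGloballyMinimal]
    [W'.IsGloballyMinimal] (L L' : PeriodPair) (hL : ModularForms.IsNeronLatticeOf (W.baseChange ℂ) L)
    (hL' : ModularForms.IsNeronLatticeOf (W'.baseChange ℂ) L') (μ : ℚ) {n : ℤ} (hn : n ≠ 0)
    (hμ : ∀ y ∈ L.lattice, (μ : ℂ) * y ∈ L'.lattice)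
    (hnμ : ∀ z ∈ L'.lattice, ∃ y ∈ L.lattice, (n : ℂ) * z = (μ : ℂ) * y) :
    ∃ k : ℤ, (k : ℚ) = μ ∧ k ∣ n := by
  obtain ⟨k, hk⟩ := integral_neronScaling_of_isGloballyMinimal_holds W W' L L' hL hL' μ hμ
  -- `μ ≠ 0`: otherwise `n ω₁' = 0`
  have hμ0 : μ ≠ 0 := by
    rintro rfl
    obtain ⟨y, -, hy⟩ := hnμ L'.ω₁ L'.ω₁_mem_lattice
    have hω : L'.ω₁ ≠ 0 := by
      have := L'.indep.ne_zero 0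
      simpa using this
    have : (n : ℂ) * L'.ω₁ = 0 := by simpa using hy
    rcases mul_eq_zero.mp this with h | h
    · exact hn (by exact_mod_cast h)
    · exact hω h
  -- the dual inclusion `(n/μ) Λ' ⊆ Λ`
  have hdual : ∀ z ∈ L'.lattice, (((n : ℚ) / μ : ℚ) : ℂ) * z ∈ L.lattice := by
    intro z hz
    obtain ⟨y, hy, hzy⟩ := hnμ z hz
    have hμC : (μ : ℂ) ≠ 0 := by exact_mod_cast hμ0
    have : (((n : ℚ) / μ : ℚ) : ℂ) * z = y := by
      push_cast
      field_simp
      linear_combination hzy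
    rw [this]; exact hy
  obtain ⟨k', hk'⟩ := integral_neronScaling_of_isGloballyMinimal_holds W' W L' L hL' hL _ hdual
  refine ⟨k, hk, k', ?_⟩
  have h : (k : ℚ) * k' = n := by
    rw [hk, hk', mul_div_cancel₀ _ hμ0]
  exact_mod_cast h.symm

/-- **A `p`-isogeny between globally minimal curves over `ℚ` scales Néron differentials by `±1` or
`±p`** (lattice form: `α Λ ⊆ Λ'` and `p Λ' ⊆ α Λ` with `α ∈ ℤ`): `p ∤ α`, or `p ∥ α`. The shape is
that of the conclusion of `gealyKlagsbrun2017_neronScalar_of_additive_potSupersingular`; here no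
reduction hypothesis is needed — over `ℚ` the row "`φ^*ω'/ω = 1 or p`" of Dokchitser–Dokchitser
2015, Table 1 (potentially good ordinary at `l = p`, [Prop. 17]) is automatic, only the criterion
"(†) `= p` iff `ker φ ⊂ Ê`" being the printed content.
[cite: DokchitserDokchitser2015LocalInvariants, Table 1 row "l = p, pot. ordinary: φ^*ω′/ω = 1 or p" (store paper:arxiv-1208.5519 p0003 L71) with §4 proof of Lemma 11 (aa′ = p)] -/
theorem not_dvd_or_dvd_and_not_sq_dvd_neronScaling_of_prime
    (W W' : WeierstrassCurve ℚ) [W.IsElliptic] [W'.IsElliptic] [W.IsGloballyMinimal]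
    [W'.IsGloballyMinimal] (L L' : PeriodPair) (hL : ModularForms.IsNeronLatticeOf (W.baseChange ℂ) L)
    (hL' : ModularForms.IsNeronLatticeOf (W'.baseChange ℂ) L') {p : ℕ} (hp : p.Prime) (α : ℤ)
    (hα : ∀ y ∈ L.lattice, (α : ℂ) * y ∈ L'.lattice)
    (hpα : ∀ z ∈ L'.lattice, ∃ y ∈ L.lattice, (p : ℂ) * z = (α : ℂ) * y) :
    ¬ (p : ℤ) ∣ α ∨ ((p : ℤ) ∣ α ∧ ¬ (p : ℤ) ^ 2 ∣ α) := by
  have hp0 : ((p : ℕ) : ℤ) ≠ 0 := by exact_mod_cast hp.ne_zero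
  obtain ⟨k, hk, hkp⟩ := exists_int_eq_and_dvd_of_neronScaling W W' L L' hL hL' (α : ℚ) hp0
    (by simpa using hα) (by simpa using hpα)
  have hkα : k = α := by exact_mod_cast hk
  subst hkα
  by_cases hdiv : (p : ℤ) ∣ k
  · refine Or.inr ⟨hdiv, fun hsq ↦ ?_⟩
    -- `p² ∣ k ∣ p` is impossible
    have : ((p : ℤ) ^ 2) ∣ (p : ℤ) := dvd_trans hsq hkp
    have h1 : (p : ℤ) ^ 2 ≤ (p : ℤ) := Int.le_of_dvd (by exact_mod_cast hp.pos) this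
    have h2 : (2 : ℤ) ≤ p := by exact_mod_cast hp.two_le
    nlinarith
  · exact Or.inl hdiv

/-- **The same dichotomy for a rational scalar `μ`** (the currency of route items that quantify over
`μ : ℚ` with `μ Λ_W ⊆ L'` and `p L' ⊆ μ Λ_W`): `μ = ±1` or `μ = ±p`, i.e. `v_p(μ) ∈ {0, 1}` and
`μ ∈ ℤ`.
[cite: DokchitserDokchitser2015LocalInvariants, Table 1 (store paper:arxiv-1208.5519 p0003 L51, L71: "1 or p") with §4 proof of Lemma 11 (aa′ = p)] -/
theorem padicValRat_neronScaling_eq_zero_or_eq_one_of_prime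
    (W W' : WeierstrassCurve ℚ) [W.IsElliptic] [W'.IsElliptic] [W.IsGloballyMinimal]
    [W'.IsGloballyMinimal] (L L' : PeriodPair) (hL : ModularForms.IsNeronLatticeOf (W.baseChange ℂ) L)
    (hL' : ModularForms.IsNeronLatticeOf (W'.baseChange ℂ) L') {p : ℕ} (hp : p.Prime) (μ : ℚ)
    (hμ : ∀ y ∈ L.lattice, (μ : ℂ) * y ∈ L'.lattice)
    (hpμ : ∀ z ∈ L'.lattice, ∃ y ∈ L.lattice, (p : ℂ) * z = (μ : ℂ) * y) :
    (∃ k : ℤ, (k : ℚ) = μ ∧ k ∣ (p : ℤ)) ∧ (padicValRat p μ = 0 ∨ padicValRat p μ = 1) := by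
  haveI := Fact.mk hp
  have hp0 : ((p : ℕ) : ℤ) ≠ 0 := by exact_mod_cast hp.ne_zero
  obtain ⟨k, hk, hkp⟩ := exists_int_eq_and_dvd_of_neronScaling W W' L L' hL hL' μ hp0 hμ
    (by simpa using hpμ)
  refine ⟨⟨k, hk, hkp⟩, ?_⟩
  subst hk
  rw [padicValRat.of_int]
  have hk0 : k ≠ 0 := fun h ↦ by subst h; exact hp.ne_zero (by exact_mod_cast zero_dvd_iff.mp hkp)
  -- `k ∣ p`: `k = ±1` or `k = ±p`
  have habs : k.natAbs ∣ p := by exact_mod_cast Int.natAbs_dvd_natAbs.mpr hkp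
  rcases (Nat.dvd_prime hp).mp habs with h1 | h2
  · left
    have : padicValInt p k = 0 := by
      refine padicValInt.eq_zero_of_not_dvd fun hpk ↦ ?_
      have := Int.natAbs_dvd_natAbs.mpr hpk
      rw [h1, Int.natAbs_natCast] at this
      exact hp.one_lt.ne' (Nat.dvd_one.mp this)
    exact_mod_cast this
  · right
    have hku : k = p ∨ k = -p := by
      rcases Int.natAbs_eq k with h | h <;> [left; right] <;> rw [h, h2]
    have : padicValInt p k = 1 := by
      rcases hku with rfl | rfl
      · exact_mod_cast padicValInt.self hp.one_lt
      · rw [padicValInt, Int.natAbs_neg, Int.natAbs_natCast]; exact padicValNat.self hp.one_lt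
    exact_mod_cast this

end Literature.NumberTheory.EllipticCurves

end
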